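import Literature.Topology.FourManifolds.SphereFourGenusOneSplitting
import Literature.Topology.FourManifolds.TorusCoordinates
import Literature.Topology.FourManifolds.ClosedBallSmoothMaps
import Literature.Topology.FourManifolds.RegularDomainMaps
import Literature.Topology.FourManifolds.CerfGammaFourProofs
import Literature.Topology.FourManifolds.SimplifiedBrokenLefschetzSphereSideTube
import Literature.Topology.FourManifolds.SectionCircleNbhd
import Mathlib.Analysis.SpecialFunctions.SmoothTransition
import HarnessLib

/-!
# The level torus `∂V₀ = S² × S¹` of the genus-one splitting of `S⁴`: fibre coordinates,
# fibrewise diffeomorphisms, smooth circle families through a cut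

Topic `Literature/Topology/FourManifolds`; infrastructure for the Laudenbach–Poénaru-free
4-sphere recognition of `SphereFourFibredRegluing.lean` (brick for the named fact
`Literature.Topology.FourManifolds.nonempty_diffeomorph_sphere_four_of_sblf_genus_one_noLefschetz`,
Baykur–Kamada 2015, Lemma 11).  Everything here is **proved**; the `def`s are explicit maps; no
named fact is introduced.

The genus-one splitting `S = W₀ ∪ V₀` of the level 4-sphere `S = {Σ xᵢ² = 1} ⊆ ℝ⁵`
(`SphereFourGenusOneSplitting.lean`: `W₀ = {x₃² + x₄² ≤ 1/2} ≅ S² × D²`,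
`V₀ = {x₃² + x₄² ≥ 1/2} ≅ B³ × S¹`) meets along the level torus
`L = {x₀² + x₁² + x₂² = 1/2 = x₃² + x₄²} = S²(1/√2) × S¹(1/√2)`.  This file sets up:

* §1 **A smooth step function** `stepFn` (`= 0` on `t ≤ 1/4`, `= 1` on `t ≥ 3/4`) and
  **smooth circle families through the cut of the angle function** `angA : 𝕊¹ → (0, 1]`
  (`TorusCoordinates.lean`): for a jointly smooth family `G t` (`t ∈ ℝ`) with `G 0 = G 1`, the
  family `u ↦ G (stepFn (angA u))` is smooth on the circle although `angA` jumps at `(1, 0)`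
  (`contMDiff_stepFamily`), and for a `1`-periodic jointly smooth `g` the straight deformation
  `(s, u) ↦ g ((1 - s) angA u + s · stepFn (angA u))` from `g ∘ angA` to `g ∘ stepFn ∘ angA`
  is smooth (`contMDiff_reparamFamily`; near the cut it is `g ((1 - s)(angB u - 1))`).
* §2 **Fibre coordinates on the level torus** `∂V₀` (the carrier of the boundary datum of the
  polar tube): the position `X : ∂V₀ → ℝ⁵`, the fibre coordinate `yS : ∂V₀ → 𝕊²`
  (`√2 (x₀, x₁, x₂)`), the base coordinate `uS : ∂V₀ → 𝕊¹` (`√2 (x₃, x₄)`), and the inverse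
  parametrisation `P : 𝕊² × 𝕊¹ → ∂V₀`, all smooth, with `P (yS z, uS z) = z`.
* §3 **Fibrewise diffeomorphisms** `fibrewise H : ∂V₀ ≃ ∂V₀`, `P (w, v) ↦ P (H v w, v)`, of a
  smooth family `H : 𝕊¹ → Diff S²` with smooth inverse family (Gluck's maps
  `(y, θ) ↦ (H_θ y, θ)` of `S² × S¹`); a base-preserving self-map is fibrewise
  (`fibrewiseFun_fibreMap`); smooth one-parameter families of them are smooth isotopies of
  gluing maps `∂W₀ → ∂V₀` (`isSmoothlyIsotopic_fibrewise`).
* §4 **Extension of a circle family of linear isometries over `V₀ ≅ B³ × S¹`**: the fibrewise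
  linear diffeomorphism `rotDiffeo : V₀ ≃ V₀`, `(p, θ) ↦ (R_θ p, θ)`, whose restriction to
  `∂V₀` is the fibrewise map of the fibre family `w ↦ R_θ w` (`restrictDiffeomorph_rotDiffeo`)
  — Gluck (1962), §5: a loop of rotations of the boundary spheres extends over `B³ × S¹`.
* §5 **Extension of a constant fibre diffeomorphism over `W₀ ≅ S² × D²`**: `constDiffeo g`,
  `(y, w) ↦ (g y, w)`, whose restriction to the level torus is the fibrewise map of the
  constant family `g` (`restrictDiffeomorph_constDiffeo`).

## References

* H. Gluck, *The embedding of two-spheres in the four-sphere*, Trans. AMS 104 (1962) 308–333,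
  §5 (regluing `S² × D²` along `S² × S¹` by `(y, θ) ↦ (ρ_θ y, θ)`). [Gluck1962]
* J. M. Lee, *Introduction to Smooth Manifolds* (2013), Cor. 5.30. [LeeSmoothManifolds2013]
-/

open scoped Manifold ContDiff Topology RealInnerProductSpace
open Set Function Filter Metric Module Complex

noncomputable section

namespace Literature.Topology.FourManifolds

/-- Local notation: `𝔼 n` is the model Euclidean space `EuclideanSpace ℝ (Fin n)`. -/
local notation "𝔼 " n:arg => EuclideanSpace ℝ (Fin n)

/-- Local notation: `𝕊 n` is the unit sphere in `EuclideanSpace ℝ (Fin (n + 1))`. -/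
local notation "𝕊 " n:arg => (Metric.sphere (0 : EuclideanSpace ℝ (Fin (n + 1))) 1)

attribute [local instance] fact_finrank_euclideanSpace_succ

namespace SphereFourSplitting

/-! ### §1 A smooth step function; smooth circle families through the cut of `angA` -/

/-- **The step function** `stepFn t = smoothTransition (2t - 1/2)`: smooth, `= 0` for `t ≤ 1/4`,
`= 1` for `t ≥ 3/4`, with values in `[0, 1]`. [folklore] -/
def stepFn (t : ℝ) : ℝ := Real.smoothTransition (2 * t - 1 / 2)

/-- `stepFn` is smooth. [folklore] -/
theorem contDiff_stepFn : ContDiff ℝ ∞ stepFn :=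
  Real.smoothTransition.contDiff.comp ((contDiff_const.mul contDiff_id).sub contDiff_const)

/-- `stepFn t = 0` for `t ≤ 1/4`. [folklore] -/
theorem stepFn_of_le {t : ℝ} (ht : t ≤ 1 / 4) : stepFn t = 0 :=
  Real.smoothTransition.zero_of_nonpos (by linarith)

/-- `stepFn t = 1` for `3/4 ≤ t`. [folklore] -/
theorem stepFn_of_ge {t : ℝ} (ht : 3 / 4 ≤ t) : stepFn t = 1 :=
  Real.smoothTransition.one_of_one_le (by linarith)

/-- `stepFn 0 = 0`. [folklore] -/
@[simp] theorem stepFn_zero : stepFn 0 = 0 := stepFn_of_le (by norm_num)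

/-- `stepFn 1 = 1`. [folklore] -/
@[simp] theorem stepFn_one : stepFn 1 = 1 := stepFn_of_ge (by norm_num)

/-- `0 ≤ stepFn t`. [folklore] -/
theorem stepFn_nonneg (t : ℝ) : 0 ≤ stepFn t := Real.smoothTransition.nonneg _

/-- `stepFn t ≤ 1`. [folklore] -/
theorem stepFn_le_one (t : ℝ) : stepFn t ≤ 1 := Real.smoothTransition.le_one _

/-- **Near the cut point `(1, 0)` the angle `angA` is close to `0` or to `1`**: eventually
`angA u < 1/4 ∨ 3/4 < angA u` (the arc `circlePt [1/4, 3/4]` is compact and misses `ptA`).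
[folklore] -/
theorem eventually_angA_near_ptA : ∀ᶠ u in 𝓝 ptA, angA u < 1 / 4 ∨ 3 / 4 < angA u := by
  have hK : IsCompact (circlePt '' Icc (1 / 4 : ℝ) (3 / 4)) :=
    (isCompact_Icc).image continuous_circlePt
  have hnot : ptA ∉ circlePt '' Icc (1 / 4 : ℝ) (3 / 4) := by
    rintro ⟨θ, hθ, hθA⟩
    have h1 : angA (circlePt θ) = θ := angA_circlePt ⟨by linarith [hθ.1], by linarith [hθ.2]⟩
    rw [hθA, angA_ptA] at h1
    linarith [hθ.2]
  have hO : IsOpen (circlePt '' Icc (1 / 4 : ℝ) (3 / 4))ᶜ := hK.isClosed.isOpen_compl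
  filter_upwards [hO.mem_nhds hnot] with u hu
  by_contra h
  push Not at h
  exact hu ⟨angA u, ⟨h.1, h.2⟩, circlePt_angA u⟩

section CircleFamilies

variable {EY HY : Type*} [NormedAddCommGroup EY] [NormedSpace ℝ EY] [TopologicalSpace HY]
  {JY : ModelWithCorners ℝ EY HY} {Y : Type*} [TopologicalSpace Y] [ChartedSpace HY Y]
  {EZ HZ : Type*} [NormedAddCommGroup EZ] [NormedSpace ℝ EZ] [TopologicalSpace HZ]
  {JZ : ModelWithCorners ℝ EZ HZ} {Z : Type*} [TopologicalSpace Z] [ChartedSpace HZ Z]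

/-- **A step function through the cut**: the hypotheses on the reparametrisation `φ` used below
(`φ = 0` on `t ≤ 1/4`, `φ = 1` on `t ≥ 3/4`; e.g. `stepFn`, or `stepFn ∘ stepFn`). [folklore] -/
structure IsCutStep (φ : ℝ → ℝ) : Prop where
  contDiff : ContDiff ℝ ∞ φ
  eq_zero : ∀ t, t ≤ 1 / 4 → φ t = 0
  eq_one : ∀ t, 3 / 4 ≤ t → φ t = 1

/-- `stepFn` is a step function through the cut. [folklore] -/
theorem isCutStep_stepFn : IsCutStep stepFn :=
  ⟨contDiff_stepFn, fun _ h => stepFn_of_le h, fun _ h => stepFn_of_ge h⟩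

/-- `stepFn ∘ stepFn` is a step function through the cut. [folklore] -/
theorem isCutStep_stepFn_stepFn : IsCutStep (stepFn ∘ stepFn) :=
  ⟨contDiff_stepFn.comp contDiff_stepFn,
    fun t h => by rw [comp_apply, stepFn_of_le h, stepFn_zero],
    fun t h => by rw [comp_apply, stepFn_of_ge h, stepFn_one]⟩

/-- A cut step vanishes at `0`. [folklore] -/
theorem IsCutStep.map_zero {φ : ℝ → ℝ} (hφ : IsCutStep φ) : φ 0 = 0 := hφ.eq_zero 0 (by norm_num)

/-- A cut step is `1` at `1`. [folklore] -/
theorem IsCutStep.map_one {φ : ℝ → ℝ} (hφ : IsCutStep φ) : φ 1 = 1 := hφ.eq_one 1 (by norm_num)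

/-- **Smooth circle families through the cut.**  Let `G t : Y → Z` (`t ∈ ℝ`) be jointly
smooth with `G 0 = G 1`, and `φ` a step function through the cut.  Then
`(u, y) ↦ G (φ (angA u)) y` is smooth on `𝕊¹ × Y`: away from `ptA` the angle `angA` is smooth,
and near `ptA` the map is `(u, y) ↦ G 0 y` because `φ (angA u) ∈ {0, 1}` there. [folklore] -/
theorem contMDiff_stepFamily {φ : ℝ → ℝ} (hφ : IsCutStep φ) {G : ℝ → Y → Z}
    (hG : ContMDiff (𝓘(ℝ, ℝ).prod JY) JZ ∞ (uncurry G)) (h01 : G 0 = G 1) :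
    ContMDiff ((𝓡 1).prod JY) JZ ∞ fun p : (𝕊 1) × Y => G (φ (angA p.1)) p.2 := by
  intro p
  by_cases hp : p.1 = ptA
  · -- near the cut the map is `(u, y) ↦ G 0 y`
    have hev : (fun q : (𝕊 1) × Y => G (φ (angA q.1)) q.2) =ᶠ[𝓝 p]
        fun q : (𝕊 1) × Y => G 0 q.2 := by
      have h1 : ∀ᶠ q in 𝓝 p, angA q.1 < 1 / 4 ∨ 3 / 4 < angA q.1 := by
        have := eventually_angA_near_ptA
        rw [← hp] at this
        exact (continuous_fst.tendsto p).eventually this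
      filter_upwards [h1] with q hq
      rcases hq with hq | hq
      · rw [hφ.eq_zero _ hq.le]
      · rw [hφ.eq_one _ hq.le, ← h01]
    refine ContMDiffAt.congr_of_eventuallyEq ?_ hev
    have h2 : ContMDiff (𝓘(ℝ, ℝ).prod JY) JZ ∞ (uncurry G) := hG
    exact (h2.comp (f := fun q : (𝕊 1) × Y => ((0 : ℝ), q.2))
      (contMDiff_const.prodMk contMDiff_snd)) p
  · have hA : ContMDiffAt ((𝓡 1).prod JY) 𝓘(ℝ, ℝ) ∞ (fun q : (𝕊 1) × Y => φ (angA q.1)) p :=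
      (hφ.contDiff.contDiffAt.comp_contMDiffAt (contMDiffAt_angA hp)).comp p contMDiffAt_fst
    exact (hG (φ (angA p.1), p.2)).comp p (hA.prodMk contMDiffAt_snd)

/-- **Smooth circle families through the cut, no extra variable**: for `G : ℝ → Z` smooth with
`G 0 = G 1`, the map `u ↦ G (φ (angA u))` is smooth on `𝕊¹`. [folklore] -/
theorem contMDiff_stepFamily' {φ : ℝ → ℝ} (hφ : IsCutStep φ) {G : ℝ → Z}
    (hG : ContMDiff 𝓘(ℝ, ℝ) JZ ∞ G) (h01 : G 0 = G 1) :
    ContMDiff (𝓡 1) JZ ∞ fun u : 𝕊 1 => G (φ (angA u)) := by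
  have h := contMDiff_stepFamily (JY := 𝓘(ℝ, ℝ)) (Y := ℝ) hφ (G := fun t (_ : ℝ) => G t)
    (hG.comp contMDiff_fst) (by rw [h01])
  exact h.comp (f := fun u : 𝕊 1 => (u, (0 : ℝ))) (contMDiff_id.prodMk contMDiff_const)

/-- **Smooth straight deformation of a periodic circle family onto its stepped form.**  Let
`g t : Y → Z` (`t ∈ ℝ`) be jointly smooth and `1`-periodic (`g (t + 1) = g t`), and `φ` a step
function through the cut.  Then `(s, u, y) ↦ g ((1 - s) angA u + s · φ (angA u)) y` is smooth on
`ℝ × 𝕊¹ × Y`; at `s = 0` it is `g (angA u)`, at `s = 1` it is `g (φ (angA u))`.  Near the cut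
point `ptA` it equals `g ((1 - s)(angB u - 1))` (by periodicity and the transition rule
`angB = angA + 1` on the upper, `angB = angA` on the lower half circle), which is smooth there.
[folklore] -/
theorem contMDiff_reparamFamily {φ : ℝ → ℝ} (hφ : IsCutStep φ) {g : ℝ → Y → Z}
    (hg : ContMDiff (𝓘(ℝ, ℝ).prod JY) JZ ∞ (uncurry g)) (hper : ∀ t, g (t + 1) = g t) :
    ContMDiff (𝓘(ℝ, ℝ).prod ((𝓡 1).prod JY)) JZ ∞ fun p : ℝ × ((𝕊 1) × Y) =>
      g ((1 - p.1) * angA p.2.1 + p.1 * φ (angA p.2.1)) p.2.2 := by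
  intro p
  by_cases hp : p.2.1 = ptA
  · have hev : (fun q : ℝ × ((𝕊 1) × Y) =>
          g ((1 - q.1) * angA q.2.1 + q.1 * φ (angA q.2.1)) q.2.2) =ᶠ[𝓝 p]
        fun q : ℝ × ((𝕊 1) × Y) => g ((1 - q.1) * (angB q.2.1 - 1)) q.2.2 := by
      have h1 : ∀ᶠ q in 𝓝 p, angA q.2.1 < 1 / 4 ∨ 3 / 4 < angA q.2.1 := by
        have := eventually_angA_near_ptA
        rw [← hp] at this
        exact ((continuous_fst.comp continuous_snd).tendsto p).eventually this
      filter_upwards [h1] with q hq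
      rcases hq with hq | hq
      · -- upper half circle: `angB = angA + 1`, `φ = 0`
        have hqA : q.2.1 ≠ ptA := fun h => by rw [h, angA_ptA] at hq; linarith
        have hqB : q.2.1 ≠ ptB := fun h => by
          have hB : angA ptB = 1 / 2 := angA_circlePt ⟨by norm_num, by norm_num⟩
          rw [h, hB] at hq; linarith
        rcases angB_eq_of_ne hqA hqB with ⟨-, hB⟩ | ⟨hlt, -⟩
        · rw [hφ.eq_zero _ hq.le, hB]
          ring_nf
        · linarith
      · -- lower half circle or the cut point: `angB = angA`, `φ = 1`
        have hB : angB q.2.1 = angA q.2.1 := by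
          by_cases hqA : q.2.1 = ptA
          · rw [hqA, angA_ptA, angB_ptA]
          · have hqB : q.2.1 ≠ ptB := fun h => by
              have hB : angA ptB = 1 / 2 := angA_circlePt ⟨by norm_num, by norm_num⟩
              rw [h, hB] at hq; linarith
            rcases angB_eq_of_ne hqA hqB with ⟨hlt, -⟩ | ⟨-, h⟩
            · linarith
            · exact h
        rw [hφ.eq_one _ hq.le, hB]
        have : (1 - q.1) * angA q.2.1 + q.1 * 1 = (1 - q.1) * (angA q.2.1 - 1) + 1 := by ring
        rw [this, hper]
    refine ContMDiffAt.congr_of_eventuallyEq ?_ hev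
    have hBat : ContMDiffAt ((𝓡 1).prod JY) 𝓘(ℝ, ℝ) ∞ (fun q : (𝕊 1) × Y => angB q.1) p.2 := by
      have hne : p.2.1 ≠ ptB := by rw [hp]; exact ptA_ne_ptB
      exact (contMDiffAt_angB hne).comp p.2 contMDiffAt_fst
    have hcoef : ContMDiffAt (𝓘(ℝ, ℝ).prod ((𝓡 1).prod JY)) 𝓘(ℝ, ℝ) ∞
        (fun q : ℝ × ((𝕊 1) × Y) => (1 - q.1) * (angB q.2.1 - 1)) p := by
      have h1 : ContMDiffAt (𝓘(ℝ, ℝ).prod ((𝓡 1).prod JY)) 𝓘(ℝ, ℝ) ∞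
          (fun q : ℝ × ((𝕊 1) × Y) => q.1) p := contMDiffAt_fst
      have h2 : ContMDiffAt (𝓘(ℝ, ℝ).prod ((𝓡 1).prod JY)) 𝓘(ℝ, ℝ) ∞
          (fun q : ℝ × ((𝕊 1) × Y) => angB q.2.1) p := hBat.comp p contMDiffAt_snd
      exact (contMDiffAt_const.sub h1).mul (h2.sub contMDiffAt_const)
    exact (hg ((1 - p.1) * (angB p.2.1 - 1), p.2.2)).comp p
      (hcoef.prodMk (contMDiffAt_snd.comp p contMDiffAt_snd))
  · have hAat : ContMDiffAt (𝓘(ℝ, ℝ).prod ((𝓡 1).prod JY)) 𝓘(ℝ, ℝ) ∞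
        (fun q : ℝ × ((𝕊 1) × Y) => angA q.2.1) p :=
      ((contMDiffAt_angA hp).comp p.2 contMDiffAt_fst).comp p contMDiffAt_snd
    have hcoef : ContMDiffAt (𝓘(ℝ, ℝ).prod ((𝓡 1).prod JY)) 𝓘(ℝ, ℝ) ∞
        (fun q : ℝ × ((𝕊 1) × Y) => (1 - q.1) * angA q.2.1 + q.1 * φ (angA q.2.1)) p := by
      have h1 : ContMDiffAt (𝓘(ℝ, ℝ).prod ((𝓡 1).prod JY)) 𝓘(ℝ, ℝ) ∞
          (fun q : ℝ × ((𝕊 1) × Y) => q.1) p := contMDiffAt_fst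
      have h3 : ContMDiffAt (𝓘(ℝ, ℝ).prod ((𝓡 1).prod JY)) 𝓘(ℝ, ℝ) ∞
          (fun q : ℝ × ((𝕊 1) × Y) => φ (angA q.2.1)) p :=
        hφ.contDiff.contDiffAt.comp_contMDiffAt hAat
      exact ((contMDiffAt_const.sub h1).mul hAat).add (h1.mul h3)
    exact (hg _).comp p (hcoef.prodMk (contMDiffAt_snd.comp p contMDiffAt_snd))

end CircleFamilies

/-! ### §2 Fibre coordinates on the level torus `L = ∂V₀ = S²(1/√2) × S¹(1/√2)` -/

/-- **The level torus** `L = ∂V₀`: the carrier of the boundary datum of the polar tube `V₀`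
(the subtype of boundary points of `V₀`, i.e. the level `x₃² + x₄² = 1/2` of `S`). [folklore] -/
abbrev LevelTorus : Type := (RegularSublevel.boundaryData hPolar).carrier

/-- **The level torus seen from the equatorial tube**: the carrier of the boundary datum of
`W₀` (the same level, as the boundary of the other piece). [folklore] -/
abbrev LevelTorusW : Type := (RegularSublevel.boundaryData isRegularLevel_tubeS).carrier

/-- The identification `∂W₀ ≅ ∂V₀` of the two faces of the level (the identity on points; the
gluing map of `S = W₀ ∪ V₀`, `isBoundaryGluing_levelSphere`). [folklore] -/
abbrev splitL : LevelTorusW ≃ₘ⟮𝓡 3, 𝓡 3⟯ LevelTorus := RegularSublevel.splitDiffeomorph isRegularLevel_tubeS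

/-- The position vector `X : ∂V₀ → ℝ⁵`. [folklore] -/
def Xv (z : LevelTorus) : 𝔼 5 := ι (ιV z.1)

/-- The position vector `X : ∂W₀ → ℝ⁵`. [folklore] -/
def Xw (z : LevelTorusW) : 𝔼 5 := ι (RegularSublevel.incl isRegularLevel_tubeS z.1)

/-- `splitL` is the identity on positions. [folklore] -/
@[simp] theorem Xv_splitL (z : LevelTorusW) : Xv (splitL z) = Xw z := rfl

/-- `splitL⁻¹` is the identity on positions. [folklore] -/
@[simp] theorem Xw_splitL_symm (z : LevelTorus) : Xw (splitL.symm z) = Xv z := by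
  conv_rhs => rw [← splitL.apply_symm_apply z]
  rfl

/-- The position map `∂V₀ → ℝ⁵` is smooth (restriction of the smooth `V₀ → S → ℝ⁵` to the
boundary, `BoundaryManifold.contMDiffAt_comp_val`). [folklore] -/
theorem contMDiff_Xv : ContMDiff (𝓡 3) 𝓘(ℝ, 𝔼 5) ∞ Xv := fun z =>
  BoundaryManifold.contMDiffAt_comp_val (h' := fun p : PolarTube => ι (ιV p))
    (((RegularLevel.contMDiff_incl _).comp (RegularSublevel.contMDiff_incl hPolar)) z.1)

/-- The position map `∂W₀ → ℝ⁵` is smooth. [folklore] -/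
theorem contMDiff_Xw : ContMDiff (𝓡 3) 𝓘(ℝ, 𝔼 5) ∞ Xw := fun z =>
  BoundaryManifold.contMDiffAt_comp_val
    (h' := fun p : EquatorTube => ι (RegularSublevel.incl isRegularLevel_tubeS p))
    (((RegularLevel.contMDiff_incl _).comp (RegularSublevel.contMDiff_incl isRegularLevel_tubeS)) z.1)

/-- The position map is injective. [folklore] -/
theorem injective_Xv : Injective Xv := fun _ _ h =>
  Subtype.ext (RegularSublevel.injective_incl hPolar (Subtype.ext h))

/-- Coordinates of a point of the level torus: `Σ xᵢ² = 1`. [folklore] -/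
theorem sqNorm_Xv (z : LevelTorus) : sqNorm (Xv z) = 1 := sqNorm_ι _

/-- Coordinates of a point of the level torus: `x₃² + x₄² = 1/2`. [folklore] -/
theorem tubeFn_Xv (z : LevelTorus) : tubeFn (Xv z) = 1 / 2 := by
  have h : (1 : ℝ) / 2 - tubeS (ιV z.1) = 0 := (RegularSublevel.mem_boundary_iff hPolar z.1).1 z.2
  have : tubeS (ιV z.1) = 1 / 2 := by linarith
  exact this

/-- `x₃² + x₄² = 1/2` on the level torus, in coordinates. [folklore] -/
theorem sum_sq_34 (z : LevelTorus) : Xv z 3 ^ 2 + Xv z 4 ^ 2 = 1 / 2 := tubeFn_Xv z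

/-- `x₀² + x₁² + x₂² = 1/2` on the level torus, in coordinates. [folklore] -/
theorem sum_sq_012 (z : LevelTorus) : Xv z 0 ^ 2 + Xv z 1 ^ 2 + Xv z 2 ^ 2 = 1 / 2 := by
  have h1 := sqNorm_Xv z
  have h2 := sum_sq_34 z
  simp only [sqNorm] at h1
  linarith

/-- `√2² = 2`. [folklore] -/
theorem sqrt_two_sq : (√2 : ℝ) ^ 2 = 2 := Real.sq_sqrt zero_le_two

/-- The fibre coordinate vector `√2 (x₀, x₁, x₂) ∈ ℝ³`. [folklore] -/
def headVec (z : LevelTorus) : 𝔼 3 :=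
  (EuclideanSpace.equiv (Fin 3) ℝ).symm ![√2 * Xv z 0, √2 * Xv z 1, √2 * Xv z 2]

/-- Coordinate formula (definitional unfolding). [folklore] -/
@[simp] theorem headVec_apply_zero (z : LevelTorus) : headVec z 0 = √2 * Xv z 0 := rfl
/-- Coordinate formula (definitional unfolding). [folklore] -/
@[simp] theorem headVec_apply_one (z : LevelTorus) : headVec z 1 = √2 * Xv z 1 := rfl
/-- Coordinate formula (definitional unfolding). [folklore] -/
@[simp] theorem headVec_apply_two (z : LevelTorus) : headVec z 2 = √2 * Xv z 2 := rfl

/-- The base coordinate vector `√2 (x₃, x₄) ∈ ℝ²`. [folklore] -/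
def baseVec (z : LevelTorus) : 𝔼 2 :=
  (EuclideanSpace.equiv (Fin 2) ℝ).symm ![√2 * Xv z 3, √2 * Xv z 4]

/-- Coordinate formula (definitional unfolding). [folklore] -/
@[simp] theorem baseVec_apply_zero (z : LevelTorus) : baseVec z 0 = √2 * Xv z 3 := rfl
/-- Coordinate formula (definitional unfolding). [folklore] -/
@[simp] theorem baseVec_apply_one (z : LevelTorus) : baseVec z 1 = √2 * Xv z 4 := rfl

/-- `√2 (x₀, x₁, x₂)` is a unit vector. [folklore] -/
theorem headVec_mem_sphere (z : LevelTorus) : headVec z ∈ Metric.sphere (0 : 𝔼 3) 1 := by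
  rw [mem_sphere_zero_iff_norm, ← sq_eq_sq₀ (norm_nonneg _) zero_le_one, one_pow,
    EuclideanSpace.norm_sq_eq, Fin.sum_univ_three]
  simp only [Real.norm_eq_abs, sq_abs, headVec_apply_zero, headVec_apply_one, headVec_apply_two]
  nlinarith [sum_sq_012 z, sqrt_two_sq]

/-- `√2 (x₃, x₄)` is a unit vector. [folklore] -/
theorem baseVec_mem_sphere (z : LevelTorus) : baseVec z ∈ Metric.sphere (0 : 𝔼 2) 1 := by
  rw [mem_sphere_zero_iff_norm, ← sq_eq_sq₀ (norm_nonneg _) zero_le_one, one_pow,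
    EuclideanSpace.norm_sq_eq, Fin.sum_univ_two]
  simp only [Real.norm_eq_abs, sq_abs, baseVec_apply_zero, baseVec_apply_one]
  nlinarith [sum_sq_34 z, sqrt_two_sq]

/-- Coordinates of the position map are smooth. [folklore] -/
theorem contMDiff_Xv_apply (i : Fin 5) : ContMDiff (𝓡 3) 𝓘(ℝ, ℝ) ∞ fun z : LevelTorus => Xv z i :=
  (EuclideanSpace.proj i).contDiff.comp_contMDiff contMDiff_Xv

/-- `headVec` is smooth. [folklore] -/
theorem contMDiff_headVec : ContMDiff (𝓡 3) 𝓘(ℝ, 𝔼 3) ∞ headVec := by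
  refine contMDiff_euclidean_of_coord fun i => ?_
  fin_cases i
  · exact contMDiff_const.mul (contMDiff_Xv_apply 0)
  · exact contMDiff_const.mul (contMDiff_Xv_apply 1)
  · exact contMDiff_const.mul (contMDiff_Xv_apply 2)

/-- `baseVec` is smooth. [folklore] -/
theorem contMDiff_baseVec : ContMDiff (𝓡 3) 𝓘(ℝ, 𝔼 2) ∞ baseVec := by
  refine contMDiff_euclidean_of_coord fun i => ?_
  fin_cases i
  · exact contMDiff_const.mul (contMDiff_Xv_apply 3)
  · exact contMDiff_const.mul (contMDiff_Xv_apply 4)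

/-- **The fibre coordinate** `y : ∂V₀ → S²`, `y = √2 (x₀, x₁, x₂)`. [folklore] -/
def yS : LevelTorus → (𝕊 2) := Set.codRestrict headVec _ headVec_mem_sphere

/-- **The base coordinate** `u : ∂V₀ → S¹`, `u = √2 (x₃, x₄)` (the round-image direction).
[folklore] -/
def uS : LevelTorus → (𝕊 1) := Set.codRestrict baseVec _ baseVec_mem_sphere

/-- Coordinate formula (definitional unfolding). [folklore] -/
@[simp] theorem coe_yS (z : LevelTorus) : ((yS z : 𝕊 2) : 𝔼 3) = headVec z := rfl
/-- Coordinate formula (definitional unfolding). [folklore] -/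
@[simp] theorem coe_uS (z : LevelTorus) : ((uS z : 𝕊 1) : 𝔼 2) = baseVec z := rfl

/-- `y` is smooth. [folklore] -/
theorem contMDiff_yS : ContMDiff (𝓡 3) (𝓡 2) ∞ yS := contMDiff_headVec.codRestrict_sphere _

/-- `u` is smooth. [folklore] -/
theorem contMDiff_uS : ContMDiff (𝓡 3) (𝓡 1) ∞ uS := contMDiff_baseVec.codRestrict_sphere _

/-- **The parametrisation vector** `(w, v) ↦ (w, v)/√2 ∈ ℝ⁵` of the level torus by `S² × S¹`.
[folklore] -/
def Pvec (p : (𝕊 2) × (𝕊 1)) : 𝔼 5 :=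
  (EuclideanSpace.equiv (Fin 5) ℝ).symm
    ![(√2)⁻¹ * (p.1 : 𝔼 3) 0, (√2)⁻¹ * (p.1 : 𝔼 3) 1, (√2)⁻¹ * (p.1 : 𝔼 3) 2,
      (√2)⁻¹ * (p.2 : 𝔼 2) 0, (√2)⁻¹ * (p.2 : 𝔼 2) 1]

/-- Coordinate formula (definitional unfolding). [folklore] -/
@[simp] theorem Pvec_apply_zero (p : (𝕊 2) × (𝕊 1)) : Pvec p 0 = (√2)⁻¹ * (p.1 : 𝔼 3) 0 := rfl
/-- Coordinate formula (definitional unfolding). [folklore] -/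
@[simp] theorem Pvec_apply_one (p : (𝕊 2) × (𝕊 1)) : Pvec p 1 = (√2)⁻¹ * (p.1 : 𝔼 3) 1 := rfl
/-- Coordinate formula (definitional unfolding). [folklore] -/
@[simp] theorem Pvec_apply_two (p : (𝕊 2) × (𝕊 1)) : Pvec p 2 = (√2)⁻¹ * (p.1 : 𝔼 3) 2 := rfl
/-- Coordinate formula (definitional unfolding). [folklore] -/
@[simp] theorem Pvec_apply_three (p : (𝕊 2) × (𝕊 1)) : Pvec p 3 = (√2)⁻¹ * (p.2 : 𝔼 2) 0 := rfl
/-- Coordinate formula (definitional unfolding). [folklore] -/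
@[simp] theorem Pvec_apply_four (p : (𝕊 2) × (𝕊 1)) : Pvec p 4 = (√2)⁻¹ * (p.2 : 𝔼 2) 1 := rfl

/-- A point `v` of `S¹` has `(v₀/√2)² + (v₁/√2)² = 1/2`. [folklore] -/
theorem sum_sq_inv_sqrt_two_mul_sphereOne (v : 𝕊 1) :
    ((√2)⁻¹ * (v : 𝔼 2) 0) ^ 2 + ((√2)⁻¹ * (v : 𝔼 2) 1) ^ 2 = 1 / 2 := by
  have h : ‖(v : 𝔼 2)‖ = 1 := norm_eq_of_mem_sphere v
  have h2 : ‖(v : 𝔼 2)‖ ^ 2 = (v : 𝔼 2) 0 ^ 2 + (v : 𝔼 2) 1 ^ 2 := by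
    rw [EuclideanSpace.norm_sq_eq, Fin.sum_univ_two]
    simp [Real.norm_eq_abs, sq_abs]
  rw [h, one_pow] at h2
  rw [mul_pow, mul_pow, ← mul_add, ← h2, mul_one, inv_pow, Real.sq_sqrt zero_le_two]
  norm_num

/-- `(1/√2)² = 1/2`. [folklore] -/
theorem inv_sqrt_two_sq : ((√2)⁻¹ : ℝ) ^ 2 = 1 / 2 := by
  rw [inv_pow, sqrt_two_sq]; norm_num

/-- `Pvec` lands on the unit sphere of `ℝ⁵`. [folklore] -/
theorem sqNorm_Pvec (p : (𝕊 2) × (𝕊 1)) : sqNorm (Pvec p) = 1 := by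
  have h1 := sum_sq_sphereTwo p.1
  have h2 := sum_sq_inv_sqrt_two_mul_sphereOne p.2
  simp only [sqNorm, Pvec_apply_zero, Pvec_apply_one, Pvec_apply_two, Pvec_apply_three,
    Pvec_apply_four]
  nlinarith [inv_sqrt_two_sq]

/-- `Pvec` lands on the level `x₃² + x₄² = 1/2`. [folklore] -/
theorem tubeFn_Pvec (p : (𝕊 2) × (𝕊 1)) : tubeFn (Pvec p) = 1 / 2 := by
  have h2 := sum_sq_inv_sqrt_two_mul_sphereOne p.2
  simp only [tubeFn, Pvec_apply_three, Pvec_apply_four]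
  linarith

/-- `Pvec` lands on Mathlib's unit sphere `𝕊⁴`. [folklore] -/
theorem Pvec_mem_sphere (p : (𝕊 2) × (𝕊 1)) : Pvec p ∈ Metric.sphere (0 : 𝔼 5) 1 := by
  have h := sqNorm_Pvec p
  rw [sqNorm_eq_norm_sq] at h
  rw [mem_sphere_zero_iff_norm]
  nlinarith [norm_nonneg (Pvec p)]

/-- `Pvec` is smooth. [folklore] -/
theorem contMDiff_Pvec : ContMDiff ((𝓡 2).prod (𝓡 1)) 𝓘(ℝ, 𝔼 5) ∞ Pvec := by
  have hθ : ∀ i : Fin 3, ContMDiff ((𝓡 2).prod (𝓡 1)) 𝓘(ℝ, ℝ) ∞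
      fun p : (𝕊 2) × (𝕊 1) => (p.1 : 𝔼 3) i := fun i =>
    ((EuclideanSpace.proj i).contDiff.comp_contMDiff contMDiff_coe_sphere).comp contMDiff_fst
  have hv : ∀ j : Fin 2, ContMDiff ((𝓡 2).prod (𝓡 1)) 𝓘(ℝ, ℝ) ∞
      fun p : (𝕊 2) × (𝕊 1) => (p.2 : 𝔼 2) j := fun j =>
    ((EuclideanSpace.proj j).contDiff.comp_contMDiff contMDiff_coe_sphere).comp contMDiff_snd
  refine contMDiff_euclidean_of_coord fun i => ?_
  fin_cases i
  · exact contMDiff_const.mul (hθ 0)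
  · exact contMDiff_const.mul (hθ 1)
  · exact contMDiff_const.mul (hθ 2)
  · exact contMDiff_const.mul (hv 0)
  · exact contMDiff_const.mul (hv 1)

/-- The parametrisation as a map into the level sphere `S` (through `S ≅ 𝕊⁴`). [folklore] -/
def PS (p : (𝕊 2) × (𝕊 1)) : LevelSphere :=
  sphereLevelDiffeomorph.symm (Set.codRestrict Pvec _ Pvec_mem_sphere p)

/-- `PS` is smooth. [folklore] -/
theorem contMDiff_PS : ContMDiff ((𝓡 2).prod (𝓡 1)) (𝓡 4) ∞ PS :=
  sphereLevelDiffeomorph.symm.contMDiff.comp (contMDiff_Pvec.codRestrict_sphere Pvec_mem_sphere)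

/-- `ι (PS p) = Pvec p`. [folklore] -/
@[simp] theorem ι_PS (p : (𝕊 2) × (𝕊 1)) : ι (PS p) = Pvec p := by
  have h := coe_sphereLevelDiffeomorph (sphereLevelDiffeomorph.symm
    (Set.codRestrict Pvec _ Pvec_mem_sphere p))
  rw [Diffeomorph.apply_symm_apply] at h
  rw [PS, ← h]
  rfl

/-- `u (PS p) = 1/2`. [folklore] -/
theorem tubeS_PS (p : (𝕊 2) × (𝕊 1)) : tubeS (PS p) = 1 / 2 := by
  rw [tubeS, ι_PS, tubeFn_Pvec]

/-- The parametrisation as a map into the polar tube `V₀`. [folklore] -/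
def PV : (𝕊 2) × (𝕊 1) → PolarTube :=
  Set.codRestrict PS _ fun p => show (1 : ℝ) / 2 - tubeS (PS p) ≤ 0 by rw [tubeS_PS]; norm_num

/-- `PV` is smooth (smoothness into the regular domain `V₀`, Lee 2013, Cor. 5.30).
[cite: LeeSmoothManifolds2013, Cor. 5.30] -/
theorem contMDiff_PV : ContMDiff ((𝓡 2).prod (𝓡 1)) (𝓡∂ 4) ∞ PV :=
  (RegularSublevel.halfSliceAtlas hPolar).contMDiff_codRestrict _ contMDiff_PS

/-- `PV` lands in the boundary `∂V₀`. [folklore] -/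
theorem PV_mem_boundary (p : (𝕊 2) × (𝕊 1)) : PV p ∈ (𝓡∂ 4).boundary PolarTube := by
  rw [RegularSublevel.mem_boundary_iff hPolar]
  show (1 : ℝ) / 2 - tubeS (PS p) = 0
  rw [tubeS_PS]; norm_num

/-- **The inverse parametrisation** `P : S² × S¹ → ∂V₀`, `(w, v) ↦ (w, v)/√2`. [folklore] -/
def P : (𝕊 2) × (𝕊 1) → LevelTorus := Set.codRestrict PV _ PV_mem_boundary

/-- `P` is smooth (smoothness into the boundary, Lee 2013, Cor. 5.30).
[cite: LeeSmoothManifolds2013, Cor. 5.30] -/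
theorem contMDiff_P : ContMDiff ((𝓡 2).prod (𝓡 1)) (𝓡 3) ∞ P :=
  BoundaryManifold.contMDiff_codRestrict PV_mem_boundary contMDiff_PV

/-- `X (P p) = Pvec p`. [folklore] -/
@[simp] theorem Xv_P (p : (𝕊 2) × (𝕊 1)) : Xv (P p) = Pvec p := ι_PS p

/-- Extensionality for `ℝ⁵` in coordinates. [folklore] -/
theorem euclidean_ext {k : ℕ} {a b : 𝔼 k} (h : ∀ i, a i = b i) : a = b :=
  (EuclideanSpace.equiv (Fin k) ℝ).injective (funext h)

/-- `√2 · (1/√2) = 1`. [folklore] -/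
theorem sqrt_two_mul_inv : (√2 : ℝ) * (√2)⁻¹ = 1 :=
  mul_inv_cancel₀ (Real.sqrt_pos.2 two_pos).ne'

/-- `(1/√2) · √2 = 1`. [folklore] -/
theorem inv_mul_sqrt_two : (√2)⁻¹ * (√2 : ℝ) = 1 :=
  inv_mul_cancel₀ (Real.sqrt_pos.2 two_pos).ne'

/-- **`P (y z, u z) = z`**: the fibre and base coordinates determine the point. [folklore] -/
@[simp] theorem P_yS_uS (z : LevelTorus) : P (yS z, uS z) = z := by
  apply injective_Xv
  rw [Xv_P]
  refine euclidean_ext fun i => ?_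
  fin_cases i
  · show (√2)⁻¹ * (√2 * Xv z 0) = Xv z 0
    rw [← mul_assoc, inv_mul_sqrt_two, one_mul]
  · show (√2)⁻¹ * (√2 * Xv z 1) = Xv z 1
    rw [← mul_assoc, inv_mul_sqrt_two, one_mul]
  · show (√2)⁻¹ * (√2 * Xv z 2) = Xv z 2
    rw [← mul_assoc, inv_mul_sqrt_two, one_mul]
  · show (√2)⁻¹ * (√2 * Xv z 3) = Xv z 3
    rw [← mul_assoc, inv_mul_sqrt_two, one_mul]
  · show (√2)⁻¹ * (√2 * Xv z 4) = Xv z 4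
    rw [← mul_assoc, inv_mul_sqrt_two, one_mul]

/-- **`y (P (w, v)) = w`**. [folklore] -/
@[simp] theorem yS_P (p : (𝕊 2) × (𝕊 1)) : yS (P p) = p.1 := by
  apply Subtype.ext
  rw [coe_yS]
  refine euclidean_ext fun i => ?_
  fin_cases i
  · show √2 * Xv (P p) 0 = (p.1 : 𝔼 3) 0
    rw [Xv_P, Pvec_apply_zero, ← mul_assoc, sqrt_two_mul_inv, one_mul]
  · show √2 * Xv (P p) 1 = (p.1 : 𝔼 3) 1
    rw [Xv_P, Pvec_apply_one, ← mul_assoc, sqrt_two_mul_inv, one_mul]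
  · show √2 * Xv (P p) 2 = (p.1 : 𝔼 3) 2
    rw [Xv_P, Pvec_apply_two, ← mul_assoc, sqrt_two_mul_inv, one_mul]

/-- **`u (P (w, v)) = v`**. [folklore] -/
@[simp] theorem uS_P (p : (𝕊 2) × (𝕊 1)) : uS (P p) = p.2 := by
  apply Subtype.ext
  rw [coe_uS]
  refine euclidean_ext fun i => ?_
  fin_cases i
  · show √2 * Xv (P p) 3 = (p.2 : 𝔼 2) 0
    rw [Xv_P, Pvec_apply_three, ← mul_assoc, sqrt_two_mul_inv, one_mul]
  · show √2 * Xv (P p) 4 = (p.2 : 𝔼 2) 1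
    rw [Xv_P, Pvec_apply_four, ← mul_assoc, sqrt_two_mul_inv, one_mul]

/-- `P` is injective. [folklore] -/
theorem injective_P : Injective P := fun p q h => by
  have h1 := congrArg yS h
  have h2 := congrArg uS h
  simp only [yS_P, uS_P] at h1 h2
  exact Prod.ext h1 h2

/-- Two points of the level torus with the same fibre and base coordinates coincide.
[folklore] -/
theorem ext_yS_uS {z z' : LevelTorus} (hy : yS z = yS z') (hu : uS z = uS z') : z = z' := by
  rw [← P_yS_uS z, ← P_yS_uS z', hy, hu]

/-! ### §3 Fibrewise self-maps of the level torus -/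

section Fibrewise

/-- **The fibrewise self-map** of the level torus defined by a family `H : S¹ → (S² → S²)`:
`P (w, v) ↦ P (H v w, v)` (in Gluck's coordinates `(y, θ) ↦ (H_θ y, θ)`).
[cite: Gluck1962, §5] -/
def fibrewiseFun (H : (𝕊 1) → (𝕊 2) → (𝕊 2)) (z : LevelTorus) : LevelTorus :=
  P (H (uS z) (yS z), uS z)

/-- Fibre coordinate of a fibrewise map. [folklore] -/
@[simp] theorem yS_fibrewiseFun (H : (𝕊 1) → (𝕊 2) → (𝕊 2)) (z : LevelTorus) :
    yS (fibrewiseFun H z) = H (uS z) (yS z) := yS_P _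

/-- A fibrewise map preserves the base coordinate. [folklore] -/
@[simp] theorem uS_fibrewiseFun (H : (𝕊 1) → (𝕊 2) → (𝕊 2)) (z : LevelTorus) :
    uS (fibrewiseFun H z) = uS z := uS_P _

/-- A fibrewise map on a parametrised point. [folklore] -/
theorem fibrewiseFun_P (H : (𝕊 1) → (𝕊 2) → (𝕊 2)) (p : (𝕊 2) × (𝕊 1)) :
    fibrewiseFun H (P p) = P (H p.2 p.1, p.2) := by
  rw [fibrewiseFun, yS_P, uS_P]

/-- Composition of fibrewise maps is fibrewise, with the fibrewise composite family. [folklore] -/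
theorem fibrewiseFun_fibrewiseFun (H H' : (𝕊 1) → (𝕊 2) → (𝕊 2)) (z : LevelTorus) :
    fibrewiseFun H (fibrewiseFun H' z) = fibrewiseFun (fun v w => H v (H' v w)) z := by
  rw [fibrewiseFun, yS_fibrewiseFun, uS_fibrewiseFun, fibrewiseFun]

/-- The fibrewise map of the identity family is the identity. [folklore] -/
@[simp] theorem fibrewiseFun_id (z : LevelTorus) : fibrewiseFun (fun _ w => w) z = z := P_yS_uS z

/-- Fibrewise maps of pointwise equal families agree. [folklore] -/
theorem fibrewiseFun_congr {H H' : (𝕊 1) → (𝕊 2) → (𝕊 2)} (h : ∀ v w, H v w = H' v w)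
    (z : LevelTorus) : fibrewiseFun H z = fibrewiseFun H' z := by
  rw [fibrewiseFun, fibrewiseFun, h]

variable {EN HN : Type*} [NormedAddCommGroup EN] [NormedSpace ℝ EN] [TopologicalSpace HN]
  {JN : ModelWithCorners ℝ EN HN} {N : Type*} [TopologicalSpace N] [ChartedSpace HN N]

/-- **Smoothness of fibrewise maps in families**: if `(n, v, w) ↦ H n v w` is smooth on
`N × S¹ × S²` then `(n, z) ↦ fibrewiseFun (H n) z` is smooth on `N × ∂V₀`. [folklore] -/
theorem contMDiff_fibrewiseFun_family {H : N → (𝕊 1) → (𝕊 2) → (𝕊 2)}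
    (hH : ContMDiff (JN.prod ((𝓡 1).prod (𝓡 2))) (𝓡 2) ∞
      fun p : N × ((𝕊 1) × (𝕊 2)) => H p.1 p.2.1 p.2.2) :
    ContMDiff (JN.prod (𝓡 3)) (𝓡 3) ∞ fun p : N × LevelTorus => fibrewiseFun (H p.1) p.2 := by
  have hu : ContMDiff (JN.prod (𝓡 3)) (𝓡 1) ∞ fun p : N × LevelTorus => uS p.2 :=
    contMDiff_uS.comp contMDiff_snd
  have hy : ContMDiff (JN.prod (𝓡 3)) (𝓡 2) ∞ fun p : N × LevelTorus => yS p.2 :=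
    contMDiff_yS.comp contMDiff_snd
  have h1 : ContMDiff (JN.prod (𝓡 3)) (𝓡 2) ∞
      fun p : N × LevelTorus => H p.1 (uS p.2) (yS p.2) :=
    hH.comp (f := fun p : N × LevelTorus => (p.1, (uS p.2, yS p.2)))
      (contMDiff_fst.prodMk (hu.prodMk hy))
  exact contMDiff_P.comp (h1.prodMk hu)

/-- **Smoothness of a fibrewise map**: if `(v, w) ↦ H v w` is smooth on `S¹ × S²` then
`fibrewiseFun H` is smooth. [folklore] -/
theorem contMDiff_fibrewiseFun {H : (𝕊 1) → (𝕊 2) → (𝕊 2)}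
    (hH : ContMDiff ((𝓡 1).prod (𝓡 2)) (𝓡 2) ∞ fun p : (𝕊 1) × (𝕊 2) => H p.1 p.2) :
    ContMDiff (𝓡 3) (𝓡 3) ∞ (fibrewiseFun H) := by
  have h := contMDiff_fibrewiseFun_family (JN := 𝓘(ℝ, ℝ)) (N := ℝ) (H := fun _ : ℝ => H)
    (hH.comp contMDiff_snd)
  exact h.comp (f := fun z : LevelTorus => ((0 : ℝ), z)) (contMDiff_const.prodMk contMDiff_id)

/-- **The fibrewise diffeomorphism** of the level torus defined by a smooth family
`H : S¹ → Diff S²` with smooth inverse family `Hinv`. [cite: Gluck1962, §5] -/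
def fibrewise (H Hinv : (𝕊 1) → (𝕊 2) → (𝕊 2))
    (hH : ContMDiff ((𝓡 1).prod (𝓡 2)) (𝓡 2) ∞ fun p : (𝕊 1) × (𝕊 2) => H p.1 p.2)
    (hHinv : ContMDiff ((𝓡 1).prod (𝓡 2)) (𝓡 2) ∞ fun p : (𝕊 1) × (𝕊 2) => Hinv p.1 p.2)
    (h₁ : ∀ v w, Hinv v (H v w) = w) (h₂ : ∀ v w, H v (Hinv v w) = w) :
    LevelTorus ≃ₘ⟮𝓡 3, 𝓡 3⟯ LevelTorus where
  toFun := fibrewiseFun H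
  invFun := fibrewiseFun Hinv
  left_inv z := by
    rw [fibrewiseFun_fibrewiseFun]
    rw [fibrewiseFun_congr (H' := fun _ w => w) (fun v w => h₁ v w), fibrewiseFun_id]
  right_inv z := by
    rw [fibrewiseFun_fibrewiseFun]
    rw [fibrewiseFun_congr (H' := fun _ w => w) (fun v w => h₂ v w), fibrewiseFun_id]
  contMDiff_toFun := contMDiff_fibrewiseFun hH
  contMDiff_invFun := contMDiff_fibrewiseFun hHinv

/-- `fibrewise H Hinv` is `fibrewiseFun H` as a function. [folklore] -/
@[simp] theorem coe_fibrewise (H Hinv : (𝕊 1) → (𝕊 2) → (𝕊 2))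
    (hH : ContMDiff ((𝓡 1).prod (𝓡 2)) (𝓡 2) ∞ fun p : (𝕊 1) × (𝕊 2) => H p.1 p.2)
    (hHinv : ContMDiff ((𝓡 1).prod (𝓡 2)) (𝓡 2) ∞ fun p : (𝕊 1) × (𝕊 2) => Hinv p.1 p.2)
    (h₁ : ∀ v w, Hinv v (H v w) = w) (h₂ : ∀ v w, H v (Hinv v w) = w) :
    ⇑(fibrewise H Hinv hH hHinv h₁ h₂) = fibrewiseFun H := rfl

/-- The inverse of `fibrewise H Hinv` is `fibrewiseFun Hinv` as a function. [folklore] -/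
@[simp] theorem coe_fibrewise_symm (H Hinv : (𝕊 1) → (𝕊 2) → (𝕊 2))
    (hH : ContMDiff ((𝓡 1).prod (𝓡 2)) (𝓡 2) ∞ fun p : (𝕊 1) × (𝕊 2) => H p.1 p.2)
    (hHinv : ContMDiff ((𝓡 1).prod (𝓡 2)) (𝓡 2) ∞ fun p : (𝕊 1) × (𝕊 2) => Hinv p.1 p.2)
    (h₁ : ∀ v w, Hinv v (H v w) = w) (h₂ : ∀ v w, H v (Hinv v w) = w) :
    ⇑(fibrewise H Hinv hH hHinv h₁ h₂).symm = fibrewiseFun Hinv := rfl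

/-- **The fibre maps of a self-map of the level torus**: `fibreMap ψ v w = y (ψ (P (w, v)))`.
[folklore] -/
def fibreMap (ψ : LevelTorus → LevelTorus) (v : 𝕊 1) (w : 𝕊 2) : 𝕊 2 := yS (ψ (P (w, v)))

/-- The fibre maps of a smooth self-map form a smooth family. [folklore] -/
theorem contMDiff_fibreMap {ψ : LevelTorus → LevelTorus} (hψ : ContMDiff (𝓡 3) (𝓡 3) ∞ ψ) :
    ContMDiff ((𝓡 1).prod (𝓡 2)) (𝓡 2) ∞ fun p : (𝕊 1) × (𝕊 2) => fibreMap ψ p.1 p.2 :=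
  contMDiff_yS.comp (hψ.comp (contMDiff_P.comp (contMDiff_snd.prodMk contMDiff_fst)))

/-- **A self-map of the level torus preserving the base coordinate is fibrewise**, with family
its fibre maps: `ψ = fibrewiseFun (fibreMap ψ)`. [folklore] -/
theorem fibrewiseFun_fibreMap {ψ : LevelTorus → LevelTorus} (hψ : ∀ z, uS (ψ z) = uS z)
    (z : LevelTorus) : fibrewiseFun (fibreMap ψ) z = ψ z := by
  apply ext_yS_uS
  · rw [yS_fibrewiseFun, fibreMap, P_yS_uS]
  · rw [uS_fibrewiseFun, hψ]

/-- The fibre maps of a fibrewise map. [folklore] -/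
@[simp] theorem fibreMap_fibrewiseFun (H : (𝕊 1) → (𝕊 2) → (𝕊 2)) (v : 𝕊 1) (w : 𝕊 2) :
    fibreMap (fibrewiseFun H) v w = H v w := by
  rw [fibreMap, yS_fibrewiseFun, uS_P, yS_P]

/-- **A smooth one-parameter family of fibrewise diffeomorphisms is a smooth isotopy** (read on
`∂W₀` through the identification `splitL : ∂W₀ ≅ ∂V₀`, as needed for gluing maps
`∂W₀ → ∂V₀`): the stages `fibrewiseFun (H σ) ∘ splitL`, `σ ∈ ℝ`. [folklore] -/
def fibrewiseIsotopy (H Hinv : ℝ → (𝕊 1) → (𝕊 2) → (𝕊 2))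
    (hH : ContMDiff (𝓘(ℝ, ℝ).prod ((𝓡 1).prod (𝓡 2))) (𝓡 2) ∞
      fun p : ℝ × ((𝕊 1) × (𝕊 2)) => H p.1 p.2.1 p.2.2)
    (hHinv : ContMDiff (𝓘(ℝ, ℝ).prod ((𝓡 1).prod (𝓡 2))) (𝓡 2) ∞
      fun p : ℝ × ((𝕊 1) × (𝕊 2)) => Hinv p.1 p.2.1 p.2.2)
    (h₁ : ∀ σ v w, Hinv σ v (H σ v w) = w) (h₂ : ∀ σ v w, H σ v (Hinv σ v w) = w) :
    SmoothIsotopy (𝓡 3) (𝓡 3) (fibrewiseFun (H 0) ∘ splitL) (fibrewiseFun (H 1) ∘ splitL) where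
  toFun σ := fibrewiseFun (H σ) ∘ splitL
  contMDiff := (contMDiff_fibrewiseFun_family hH).comp
    (contMDiff_fst.prodMk (splitL.contMDiff.comp contMDiff_snd))
  isSmoothEmbedding σ := by
    have hσ : ContMDiff ((𝓡 1).prod (𝓡 2)) (𝓡 2) ∞ fun p : (𝕊 1) × (𝕊 2) => H σ p.1 p.2 :=
      hH.comp (f := fun p : (𝕊 1) × (𝕊 2) => (σ, p)) (contMDiff_const.prodMk contMDiff_id)
    have hσ' : ContMDiff ((𝓡 1).prod (𝓡 2)) (𝓡 2) ∞ fun p : (𝕊 1) × (𝕊 2) => Hinv σ p.1 p.2 :=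
      hHinv.comp (f := fun p : (𝕊 1) × (𝕊 2) => (σ, p)) (contMDiff_const.prodMk contMDiff_id)
    exact Diffeomorph.isSmoothEmbedding'
      (splitL.trans (fibrewise (H σ) (Hinv σ) hσ hσ' (h₁ σ) (h₂ σ)))
  map_zero := rfl
  map_one := rfl

/-- Stages of `fibrewiseIsotopy` (definitional). [folklore] -/
@[simp] theorem fibrewiseIsotopy_toFun (H Hinv : ℝ → (𝕊 1) → (𝕊 2) → (𝕊 2))
    (hH : ContMDiff (𝓘(ℝ, ℝ).prod ((𝓡 1).prod (𝓡 2))) (𝓡 2) ∞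
      fun p : ℝ × ((𝕊 1) × (𝕊 2)) => H p.1 p.2.1 p.2.2)
    (hHinv : ContMDiff (𝓘(ℝ, ℝ).prod ((𝓡 1).prod (𝓡 2))) (𝓡 2) ∞
      fun p : ℝ × ((𝕊 1) × (𝕊 2)) => Hinv p.1 p.2.1 p.2.2)
    (h₁ : ∀ σ v w, Hinv σ v (H σ v w) = w) (h₂ : ∀ σ v w, H σ v (Hinv σ v w) = w) (σ : ℝ) :
    (fibrewiseIsotopy H Hinv hH hHinv h₁ h₂).toFun σ = fibrewiseFun (H σ) ∘ splitL := rfl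

/-- **Smoothly isotopic fibrewise gluing maps**: the two ends of a smooth one-parameter family
of fibrewise diffeomorphisms, composed with `splitL`, are smoothly isotopic maps `∂W₀ → ∂V₀`.
[folklore] -/
theorem isSmoothlyIsotopic_fibrewise (H Hinv : ℝ → (𝕊 1) → (𝕊 2) → (𝕊 2))
    (hH : ContMDiff (𝓘(ℝ, ℝ).prod ((𝓡 1).prod (𝓡 2))) (𝓡 2) ∞
      fun p : ℝ × ((𝕊 1) × (𝕊 2)) => H p.1 p.2.1 p.2.2)
    (hHinv : ContMDiff (𝓘(ℝ, ℝ).prod ((𝓡 1).prod (𝓡 2))) (𝓡 2) ∞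
      fun p : ℝ × ((𝕊 1) × (𝕊 2)) => Hinv p.1 p.2.1 p.2.2)
    (h₁ : ∀ σ v w, Hinv σ v (H σ v w) = w) (h₂ : ∀ σ v w, H σ v (Hinv σ v w) = w) :
    IsSmoothlyIsotopic (𝓡 3) (𝓡 3) (fibrewiseFun (H 0) ∘ splitL) (fibrewiseFun (H 1) ∘ splitL) :=
  ⟨fibrewiseIsotopy H Hinv hH hHinv h₁ h₂⟩

end Fibrewise

/-! ### §4 Extension of a circle family of rotations over the polar tube `V₀ ≅ B³ × S¹` -/

section PolarExtension

/-- The head `(x₀, x₁, x₂) ∈ ℝ³` of a vector of `ℝ⁵`. [folklore] -/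
def head3 (x : 𝔼 5) : 𝔼 3 := (EuclideanSpace.equiv (Fin 3) ℝ).symm ![x 0, x 1, x 2]

/-- Coordinate formula (definitional unfolding). [folklore] -/
@[simp] theorem head3_apply_zero (x : 𝔼 5) : head3 x 0 = x 0 := rfl
/-- Coordinate formula (definitional unfolding). [folklore] -/
@[simp] theorem head3_apply_one (x : 𝔼 5) : head3 x 1 = x 1 := rfl
/-- Coordinate formula (definitional unfolding). [folklore] -/
@[simp] theorem head3_apply_two (x : 𝔼 5) : head3 x 2 = x 2 := rfl

/-- Coordinates of `ℝᵏ` are smooth. [folklore] -/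
theorem contDiff_apply_euclidean {k : ℕ} (i : Fin k) : ContDiff ℝ ∞ fun x : 𝔼 k => x i :=
  (EuclideanSpace.proj (𝕜 := ℝ) i : 𝔼 k →L[ℝ] ℝ).contDiff

/-- `head3` is smooth (it is linear). [folklore] -/
theorem contDiff_head3 : ContDiff ℝ ∞ head3 := by
  rw [contDiff_euclidean]
  intro i
  fin_cases i
  · exact contDiff_apply_euclidean (0 : Fin 5)
  · exact contDiff_apply_euclidean (1 : Fin 5)
  · exact contDiff_apply_euclidean (2 : Fin 5)

/-- `head3` is additive-homogeneous: `head3 (a • x) = a • head3 x` coordinatewise. [folklore] -/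
theorem head3_smul (a : ℝ) (x : 𝔼 5) : head3 (a • x) = a • head3 x := by
  refine euclidean_ext fun i => ?_
  fin_cases i <;> simp [head3]

/-- `|head3 x|² = x₀² + x₁² + x₂²`. [folklore] -/
theorem norm_head3_sq (x : 𝔼 5) : ‖head3 x‖ ^ 2 = x 0 ^ 2 + x 1 ^ 2 + x 2 ^ 2 := by
  rw [EuclideanSpace.norm_sq_eq, Fin.sum_univ_three]
  simp [Real.norm_eq_abs, sq_abs]

/-- **Reassembling a vector of `ℝ⁵` from a new head and the old tail** `(h, x₃, x₄)`. [folklore] -/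
def withHead (h : 𝔼 3) (x : 𝔼 5) : 𝔼 5 :=
  (EuclideanSpace.equiv (Fin 5) ℝ).symm ![h 0, h 1, h 2, x 3, x 4]

/-- Coordinate formula (definitional unfolding). [folklore] -/
@[simp] theorem withHead_apply_zero (h : 𝔼 3) (x : 𝔼 5) : withHead h x 0 = h 0 := rfl
/-- Coordinate formula (definitional unfolding). [folklore] -/
@[simp] theorem withHead_apply_one (h : 𝔼 3) (x : 𝔼 5) : withHead h x 1 = h 1 := rfl
/-- Coordinate formula (definitional unfolding). [folklore] -/
@[simp] theorem withHead_apply_two (h : 𝔼 3) (x : 𝔼 5) : withHead h x 2 = h 2 := rfl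
/-- Coordinate formula (definitional unfolding). [folklore] -/
@[simp] theorem withHead_apply_three (h : 𝔼 3) (x : 𝔼 5) : withHead h x 3 = x 3 := rfl
/-- Coordinate formula (definitional unfolding). [folklore] -/
@[simp] theorem withHead_apply_four (h : 𝔼 3) (x : 𝔼 5) : withHead h x 4 = x 4 := rfl

/-- `withHead (head3 x) x = x`. [folklore] -/
@[simp] theorem withHead_head3 (x : 𝔼 5) : withHead (head3 x) x = x := by
  refine euclidean_ext fun i => ?_
  fin_cases i <;> rfl

/-- `head3 (withHead h x) = h`. [folklore] -/
@[simp] theorem head3_withHead (h : 𝔼 3) (x : 𝔼 5) : head3 (withHead h x) = h := by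
  refine euclidean_ext fun i => ?_
  fin_cases i <;> rfl

/-- `withHead h (withHead h' x) = withHead h x`. [folklore] -/
@[simp] theorem withHead_withHead (h h' : 𝔼 3) (x : 𝔼 5) : withHead h (withHead h' x) = withHead h x := by
  refine euclidean_ext fun i => ?_
  fin_cases i <;> rfl

/-- The tube function only sees the tail: `u (withHead h x) = u x`. [folklore] -/
@[simp] theorem tubeFn_withHead (h : 𝔼 3) (x : 𝔼 5) : tubeFn (withHead h x) = tubeFn x := rfl

/-- Square norm of a reassembled vector. [folklore] -/
theorem sqNorm_withHead (h : 𝔼 3) (x : 𝔼 5) : sqNorm (withHead h x) = ‖h‖ ^ 2 + tubeFn x := by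
  have h3 : ‖h‖ ^ 2 = h 0 ^ 2 + h 1 ^ 2 + h 2 ^ 2 := by
    rw [EuclideanSpace.norm_sq_eq, Fin.sum_univ_three]
    simp [Real.norm_eq_abs, sq_abs]
  rw [h3]
  simp [sqNorm, tubeFn]
  ring

/-- `sqNorm x = |head3 x|² + u x`. [folklore] -/
theorem sqNorm_eq_head_add_tube (x : 𝔼 5) : sqNorm x = ‖head3 x‖ ^ 2 + tubeFn x := by
  rw [norm_head3_sq]; simp [sqNorm, tubeFn]; ring

/-- `withHead` is smooth in both arguments. [folklore] -/
theorem contDiff_withHead : ContDiff ℝ ∞ fun p : 𝔼 3 × 𝔼 5 => withHead p.1 p.2 := by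
  rw [contDiff_euclidean]
  intro i
  have h1 : ∀ j : Fin 3, ContDiff ℝ ∞ fun p : 𝔼 3 × 𝔼 5 => p.1 j :=
    fun j => (contDiff_apply_euclidean j).comp contDiff_fst
  have h2 : ∀ j : Fin 5, ContDiff ℝ ∞ fun p : 𝔼 3 × 𝔼 5 => p.2 j :=
    fun j => (contDiff_apply_euclidean j).comp contDiff_snd
  fin_cases i
  · exact h1 0
  · exact h1 1
  · exact h1 2
  · exact h2 3
  · exact h2 4

/-- The position vector on the polar tube, `V₀ → ℝ⁵`. [folklore] -/
abbrev XV (q : PolarTube) : 𝔼 5 := ι (ιV q)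

/-- The position map `V₀ → ℝ⁵` is smooth. [folklore] -/
theorem contMDiff_XV : ContMDiff (𝓡∂ 4) 𝓘(ℝ, 𝔼 5) ∞ XV :=
  (RegularLevel.contMDiff_incl _).comp (RegularSublevel.contMDiff_incl hPolar)

/-- On `V₀`, `u = x₃² + x₄² ≥ 1/2 > 0`. [folklore] -/
theorem tubeFn_XV_pos (q : PolarTube) : 0 < tubeFn (XV q) := by
  have h := half_le_tubeS_ιV q
  rw [tubeS] at h
  linarith

/-- The base direction vector `(x₃, x₄)/√u ∈ ℝ²` on the polar tube. [folklore] -/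
def baseVecV (q : PolarTube) : 𝔼 2 :=
  (EuclideanSpace.equiv (Fin 2) ℝ).symm
    ![(√(tubeFn (XV q)))⁻¹ * XV q 3, (√(tubeFn (XV q)))⁻¹ * XV q 4]

/-- Coordinate formula (definitional unfolding). [folklore] -/
@[simp] theorem baseVecV_apply_zero (q : PolarTube) :
    baseVecV q 0 = (√(tubeFn (XV q)))⁻¹ * XV q 3 := rfl
/-- Coordinate formula (definitional unfolding). [folklore] -/
@[simp] theorem baseVecV_apply_one (q : PolarTube) :
    baseVecV q 1 = (√(tubeFn (XV q)))⁻¹ * XV q 4 := rfl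

/-- The base direction is a unit vector. [folklore] -/
theorem baseVecV_mem_sphere (q : PolarTube) : baseVecV q ∈ Metric.sphere (0 : 𝔼 2) 1 := by
  have hu := tubeFn_XV_pos q
  have hs : (√(tubeFn (XV q)))⁻¹ ^ 2 * tubeFn (XV q) = 1 := by
    rw [inv_pow, Real.sq_sqrt hu.le, inv_mul_cancel₀ hu.ne']
  rw [mem_sphere_zero_iff_norm, ← sq_eq_sq₀ (norm_nonneg _) zero_le_one, one_pow,
    EuclideanSpace.norm_sq_eq, Fin.sum_univ_two]
  simp only [Real.norm_eq_abs, sq_abs, baseVecV_apply_zero, baseVecV_apply_one]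
  simp only [tubeFn] at hs ⊢
  nlinarith

/-- `baseVecV` is smooth (`√u` is smooth where `u > 0`). [folklore] -/
theorem contMDiff_baseVecV : ContMDiff (𝓡∂ 4) 𝓘(ℝ, 𝔼 2) ∞ baseVecV := by
  have hc : ∀ i : Fin 5, ContMDiff (𝓡∂ 4) 𝓘(ℝ, ℝ) ∞ fun q : PolarTube => XV q i :=
    fun i => (EuclideanSpace.proj i).contDiff.comp_contMDiff contMDiff_XV
  have hu : ContMDiff (𝓡∂ 4) 𝓘(ℝ, ℝ) ∞ fun q : PolarTube => tubeFn (XV q) :=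
    contDiff_tubeFn.comp_contMDiff contMDiff_XV
  have hr : ContMDiff (𝓡∂ 4) 𝓘(ℝ, ℝ) ∞ fun q : PolarTube => (√(tubeFn (XV q)))⁻¹ := by
    intro q
    have h1 : ContDiffAt ℝ ∞ (fun t : ℝ => (√t)⁻¹) (tubeFn (XV q)) :=
      (Real.contDiffAt_sqrt (tubeFn_XV_pos q).ne').inv
        (Real.sqrt_pos.2 (tubeFn_XV_pos q)).ne'
    exact h1.comp_contMDiffAt (f := fun q : PolarTube => tubeFn (XV q)) (hu q)
  refine contMDiff_euclidean_of_coord fun i => ?_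
  fin_cases i
  · exact hr.mul (hc 3)
  · exact hr.mul (hc 4)

/-- **The base direction** `uV : V₀ → S¹`, `(x₃, x₄)/√u`; on `∂V₀` it is `uS`. [folklore] -/
def uV : PolarTube → (𝕊 1) := Set.codRestrict baseVecV _ baseVecV_mem_sphere

/-- Coordinate formula (definitional unfolding). [folklore] -/
@[simp] theorem coe_uV (q : PolarTube) : ((uV q : 𝕊 1) : 𝔼 2) = baseVecV q := rfl

/-- `uV` is smooth. [folklore] -/
theorem contMDiff_uV : ContMDiff (𝓡∂ 4) (𝓡 1) ∞ uV := contMDiff_baseVecV.codRestrict_sphere _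

/-- On the boundary `∂V₀` (where `u = 1/2`), `uV = uS`. [folklore] -/
theorem uV_boundary (z : LevelTorus) : uV z.1 = uS z := by
  apply Subtype.ext
  rw [coe_uV, coe_uS]
  have hu : tubeFn (XV z.1) = 1 / 2 := tubeFn_Xv z
  have hs : (√(tubeFn (XV z.1)))⁻¹ = √2 := by
    rw [hu, Real.sqrt_div' _ zero_le_two, Real.sqrt_one, inv_div, div_one]
  refine euclidean_ext fun i => ?_
  fin_cases i
  · show (√(tubeFn (XV z.1)))⁻¹ * XV z.1 3 = √2 * Xv z 3
    rw [hs]; rfl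
  · show (√(tubeFn (XV z.1)))⁻¹ * XV z.1 4 = √2 * Xv z 4
    rw [hs]; rfl

/-- **The inverses of a smooth family of linear isometries form a smooth family** (as continuous
linear maps: `A_t⁻¹ = Ring.inverse A_t`, and `Ring.inverse` is smooth at units). [folklore] -/
theorem contDiff_symm_family {k : ℕ} {A : ℝ → (𝔼 k ≃ₗᵢ[ℝ] 𝔼 k)}
    (hA : ContDiff ℝ ∞ fun t => (A t : 𝔼 k →L[ℝ] 𝔼 k)) :
    ContDiff ℝ ∞ fun t => ((A t).symm : 𝔼 k →L[ℝ] 𝔼 k) := by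
  have hAunit : ∀ t, IsUnit (A t : 𝔼 k →L[ℝ] 𝔼 k) := fun t =>
    ContinuousLinearMap.isUnit_iff_bijective.mpr (A t).bijective
  have hAinv : ∀ t y, Ring.inverse (A t : 𝔼 k →L[ℝ] 𝔼 k) y = (A t).symm y := by
    intro t y
    have h1 : Ring.inverse (A t : 𝔼 k →L[ℝ] 𝔼 k) * (A t : 𝔼 k →L[ℝ] 𝔼 k) = 1 :=
      Ring.inverse_mul_cancel _ (hAunit t)
    have h2 := congrArg (fun L : 𝔼 k →L[ℝ] 𝔼 k => L ((A t).symm y)) h1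
    simp only [mul_apply_eq_comp, one_apply_eq_self] at h2
    rw [← h2]
    congr 1
    exact ((A t).apply_symm_apply y).symm
  have h1 : ContDiff ℝ ∞ fun t => Ring.inverse (A t : 𝔼 k →L[ℝ] 𝔼 k) := by
    rw [contDiff_iff_contDiffAt]
    intro t
    have h3 : ContDiffAt ℝ ∞ Ring.inverse (A t : 𝔼 k →L[ℝ] 𝔼 k) := by
      have := contDiffAt_ringInverse ℝ (n := ∞) (hAunit t).unit
      rwa [(hAunit t).unit_spec] at this
    exact h3.comp t hA.contDiffAt
  have hfun : (fun t => ((A t).symm : 𝔼 k →L[ℝ] 𝔼 k)) = fun t => Ring.inverse (A t : 𝔼 k →L[ℝ] 𝔼 k) :=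
    funext fun t => ContinuousLinearMap.ext fun y => (hAinv t y).symm
  rw [hfun]
  exact h1

variable (R Rinv : (𝕊 1) → (𝔼 3 →L[ℝ] 𝔼 3))

/-- **The fibrewise linear vector field of a circle family of linear maps**:
`x ↦ (R(u(x)) · (x₀, x₁, x₂), x₃, x₄)` on the polar tube. [cite: Gluck1962, §5] -/
def rotVec (q : PolarTube) : 𝔼 5 := withHead (R (uV q) (head3 (XV q))) (XV q)

/-- `rotVec` is smooth for a smooth family `R`. [folklore] -/
theorem contMDiff_rotVec (hR : ContMDiff (𝓡 1) 𝓘(ℝ, 𝔼 3 →L[ℝ] 𝔼 3) ∞ R) :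
    ContMDiff (𝓡∂ 4) 𝓘(ℝ, 𝔼 5) ∞ (rotVec R) := by
  have h1 : ContMDiff (𝓡∂ 4) 𝓘(ℝ, 𝔼 3 →L[ℝ] 𝔼 3) ∞ fun q : PolarTube => R (uV q) :=
    hR.comp contMDiff_uV
  have h2 : ContMDiff (𝓡∂ 4) 𝓘(ℝ, 𝔼 3) ∞ fun q : PolarTube => head3 (XV q) :=
    contDiff_head3.comp_contMDiff contMDiff_XV
  have h3 : ContMDiff (𝓡∂ 4) 𝓘(ℝ, 𝔼 3) ∞ fun q : PolarTube => R (uV q) (head3 (XV q)) :=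
    h1.clm_apply h2
  exact contDiff_withHead.comp_contMDiff (h3.prodMk_space contMDiff_XV)

variable {R Rinv}

/-- For a family of isometries, `rotVec` preserves the square norm. [folklore] -/
theorem sqNorm_rotVec (hiso : ∀ v h, ‖R v h‖ = ‖h‖) (q : PolarTube) : sqNorm (rotVec R q) = 1 := by
  rw [rotVec, sqNorm_withHead, hiso, ← sqNorm_eq_head_add_tube]
  exact sqNorm_ι _

/-- `rotVec` preserves the tube function. [folklore] -/
@[simp] theorem tubeFn_rotVec (q : PolarTube) : tubeFn (rotVec R q) = tubeFn (XV q) := by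
  rw [rotVec, tubeFn_withHead]

/-- `rotVec` lands on Mathlib's unit sphere `𝕊⁴` (for a family of isometries). [folklore] -/
theorem rotVec_mem_sphere (hiso : ∀ v h, ‖R v h‖ = ‖h‖) (q : PolarTube) :
    rotVec R q ∈ Metric.sphere (0 : 𝔼 5) 1 := by
  have h := sqNorm_rotVec hiso q
  rw [sqNorm_eq_norm_sq] at h
  rw [mem_sphere_zero_iff_norm]
  nlinarith [norm_nonneg (rotVec R q)]

/-- The rotated point as a point of the level sphere `S`. [folklore] -/
def rotS (hiso : ∀ v h, ‖R v h‖ = ‖h‖) (q : PolarTube) : LevelSphere :=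
  sphereLevelDiffeomorph.symm (Set.codRestrict (rotVec R) _ (rotVec_mem_sphere hiso) q)

/-- `ι (rotS q) = rotVec q`. [folklore] -/
@[simp] theorem ι_rotS (hiso : ∀ v h, ‖R v h‖ = ‖h‖) (q : PolarTube) : ι (rotS hiso q) = rotVec R q := by
  have h := coe_sphereLevelDiffeomorph (sphereLevelDiffeomorph.symm
    (Set.codRestrict (rotVec R) _ (rotVec_mem_sphere hiso) q))
  rw [Diffeomorph.apply_symm_apply] at h
  rw [rotS, ← h]
  rfl

/-- `rotS` is smooth. [folklore] -/
theorem contMDiff_rotS (hR : ContMDiff (𝓡 1) 𝓘(ℝ, 𝔼 3 →L[ℝ] 𝔼 3) ∞ R) (hiso : ∀ v h, ‖R v h‖ = ‖h‖) :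
    ContMDiff (𝓡∂ 4) (𝓡 4) ∞ (rotS hiso) :=
  sphereLevelDiffeomorph.symm.contMDiff.comp ((contMDiff_rotVec R hR).codRestrict_sphere _)

/-- `rotS` stays in the polar tube. [folklore] -/
theorem rotS_mem (hiso : ∀ v h, ‖R v h‖ = ‖h‖) (q : PolarTube) :
    (1 : ℝ) / 2 - tubeS (rotS hiso q) ≤ 0 := by
  have h := half_le_tubeS_ιV q
  rw [tubeS, ι_rotS, tubeFn_rotVec]
  rw [tubeS] at h
  linarith

/-- **The fibrewise linear self-map of the polar tube** `V₀` defined by the circle family `R` of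
isometries of `ℝ³`: `(p, θ) ↦ (R_θ p, θ)` on `V₀ ≅ B³ × S¹`. [cite: Gluck1962, §5] -/
def rotV (hiso : ∀ v h, ‖R v h‖ = ‖h‖) : PolarTube → PolarTube :=
  Set.codRestrict (rotS hiso) _ (rotS_mem hiso)

/-- `rotV` is smooth (Lee 2013, Cor. 5.30). [cite: LeeSmoothManifolds2013, Cor. 5.30] -/
theorem contMDiff_rotV (hR : ContMDiff (𝓡 1) 𝓘(ℝ, 𝔼 3 →L[ℝ] 𝔼 3) ∞ R) (hiso : ∀ v h, ‖R v h‖ = ‖h‖) :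
    ContMDiff (𝓡∂ 4) (𝓡∂ 4) ∞ (rotV hiso) :=
  (RegularSublevel.halfSliceAtlas hPolar).contMDiff_codRestrict _ (contMDiff_rotS hR hiso)

/-- Position of `rotV q`. [folklore] -/
@[simp] theorem XV_rotV (hiso : ∀ v h, ‖R v h‖ = ‖h‖) (q : PolarTube) : XV (rotV hiso q) = rotVec R q :=
  ι_rotS hiso q

/-- `rotV` preserves the base direction. [folklore] -/
@[simp] theorem uV_rotV (hiso : ∀ v h, ‖R v h‖ = ‖h‖) (q : PolarTube) : uV (rotV hiso q) = uV q := by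
  apply Subtype.ext
  rw [coe_uV, coe_uV]
  refine euclidean_ext fun i => ?_
  fin_cases i
  · show (√(tubeFn (XV (rotV hiso q))))⁻¹ * XV (rotV hiso q) 3 = (√(tubeFn (XV q)))⁻¹ * XV q 3
    rw [XV_rotV, tubeFn_rotVec]; rfl
  · show (√(tubeFn (XV (rotV hiso q))))⁻¹ * XV (rotV hiso q) 4 = (√(tubeFn (XV q)))⁻¹ * XV q 4
    rw [XV_rotV, tubeFn_rotVec]; rfl

/-- Composition of two fibrewise linear maps of the polar tube. [folklore] -/
theorem rotV_rotV (hiso : ∀ v h, ‖R v h‖ = ‖h‖) (hiso' : ∀ v h, ‖Rinv v h‖ = ‖h‖)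
    (hRR : ∀ v h, Rinv v (R v h) = h) (q : PolarTube) : rotV hiso' (rotV hiso q) = q := by
  apply RegularSublevel.injective_incl hPolar
  apply Subtype.ext
  show XV (rotV hiso' (rotV hiso q)) = XV q
  rw [XV_rotV, rotVec, uV_rotV, XV_rotV, rotVec, head3_withHead, hRR, withHead_withHead,
    withHead_head3]

/-- **The fibrewise linear diffeomorphism of the polar tube** defined by a smooth circle family
`R` of linear isometries of `ℝ³` with smooth inverse family `Rinv`: on `V₀ ≅ B³ × S¹` it is
`(p, θ) ↦ (R_θ p, θ)` — the extension over `S¹ × B³` of a loop of rotations of the boundary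
spheres (Gluck 1962, §5: the map `(y, θ) ↦ (ρ_θ y, θ)` of `S² × S¹` extends over `B³ × S¹`).
[cite: Gluck1962, §5] -/
def rotDiffeo (hR : ContMDiff (𝓡 1) 𝓘(ℝ, 𝔼 3 →L[ℝ] 𝔼 3) ∞ R)
    (hRinv : ContMDiff (𝓡 1) 𝓘(ℝ, 𝔼 3 →L[ℝ] 𝔼 3) ∞ Rinv)
    (hiso : ∀ v h, ‖R v h‖ = ‖h‖) (hiso' : ∀ v h, ‖Rinv v h‖ = ‖h‖)
    (h₁ : ∀ v h, Rinv v (R v h) = h) (h₂ : ∀ v h, R v (Rinv v h) = h) :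
    PolarTube ≃ₘ⟮𝓡∂ 4, 𝓡∂ 4⟯ PolarTube where
  toFun := rotV hiso
  invFun := rotV hiso'
  left_inv := rotV_rotV hiso hiso' h₁
  right_inv := rotV_rotV hiso' hiso h₂
  contMDiff_toFun := contMDiff_rotV hR hiso
  contMDiff_invFun := contMDiff_rotV hRinv hiso'

/-- `rotDiffeo` as a function. [folklore] -/
@[simp] theorem coe_rotDiffeo (hR : ContMDiff (𝓡 1) 𝓘(ℝ, 𝔼 3 →L[ℝ] 𝔼 3) ∞ R)
    (hRinv : ContMDiff (𝓡 1) 𝓘(ℝ, 𝔼 3 →L[ℝ] 𝔼 3) ∞ Rinv)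
    (hiso : ∀ v h, ‖R v h‖ = ‖h‖) (hiso' : ∀ v h, ‖Rinv v h‖ = ‖h‖)
    (h₁ : ∀ v h, Rinv v (R v h) = h) (h₂ : ∀ v h, R v (Rinv v h) = h) :
    ⇑(rotDiffeo hR hRinv hiso hiso' h₁ h₂) = rotV hiso := rfl

/-- The linear maps of a family of isometries restrict to the unit sphere. [folklore] -/
theorem rot_mem_sphere (hiso : ∀ v h, ‖R v h‖ = ‖h‖) (v : 𝕊 1) (w : 𝕊 2) :
    R v w ∈ Metric.sphere (0 : 𝔼 3) 1 := by
  rw [mem_sphere_zero_iff_norm, hiso, norm_eq_of_mem_sphere]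

/-- **The boundary family of `rotDiffeo`**: the fibre maps `w ↦ R_v w` of the unit sphere.
[folklore] -/
def rotFibre (hiso : ∀ v h, ‖R v h‖ = ‖h‖) (v : 𝕊 1) (w : 𝕊 2) : 𝕊 2 :=
  ⟨R v w, rot_mem_sphere hiso v w⟩

/-- Coordinate formula (definitional unfolding). [folklore] -/
@[simp] theorem coe_rotFibre (hiso : ∀ v h, ‖R v h‖ = ‖h‖) (v : 𝕊 1) (w : 𝕊 2) :
    ((rotFibre hiso v w : 𝕊 2) : 𝔼 3) = R v w := rfl

/-- **The restriction of `rotDiffeo` to the level torus `∂V₀` is the fibrewise map of its fibre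
family** (read through the boundary datum: `incl (∂Φ z) = Φ (incl z)` determines `∂Φ`).
[folklore] -/
theorem restrictDiffeomorph_rotDiffeo (hR : ContMDiff (𝓡 1) 𝓘(ℝ, 𝔼 3 →L[ℝ] 𝔼 3) ∞ R)
    (hRinv : ContMDiff (𝓡 1) 𝓘(ℝ, 𝔼 3 →L[ℝ] 𝔼 3) ∞ Rinv)
    (hiso : ∀ v h, ‖R v h‖ = ‖h‖) (hiso' : ∀ v h, ‖Rinv v h‖ = ‖h‖)
    (h₁ : ∀ v h, Rinv v (R v h) = h) (h₂ : ∀ v h, R v (Rinv v h) = h) (z : LevelTorus) :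
    (RegularSublevel.boundaryData hPolar).restrictDiffeomorph (RegularSublevel.boundaryData hPolar)
        (rotDiffeo hR hRinv hiso hiso' h₁ h₂) z =
      fibrewiseFun (rotFibre hiso) z := by
  apply injective_Xv
  have hincl := BoundaryData.incl_restrictDiffeomorph
    (b₁ := RegularSublevel.boundaryData hPolar) (b₂ := RegularSublevel.boundaryData hPolar)
    (rotDiffeo hR hRinv hiso hiso' h₁ h₂) z
  -- positions: left-hand side
  have hL : Xv ((RegularSublevel.boundaryData hPolar).restrictDiffeomorph
      (RegularSublevel.boundaryData hPolar) (rotDiffeo hR hRinv hiso hiso' h₁ h₂) z) = rotVec R z.1 := by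
    show XV ((RegularSublevel.boundaryData hPolar).incl _) = _
    rw [hincl]
    exact XV_rotV hiso z.1
  rw [hL, fibrewiseFun, Xv_P, rotVec, uV_boundary]
  have hh : head3 (XV z.1) = (√2)⁻¹ • headVec z := by
    refine euclidean_ext fun i => ?_
    fin_cases i
    · show Xv z 0 = (√2)⁻¹ * (√2 * Xv z 0); rw [← mul_assoc, inv_mul_sqrt_two, one_mul]
    · show Xv z 1 = (√2)⁻¹ * (√2 * Xv z 1); rw [← mul_assoc, inv_mul_sqrt_two, one_mul]
    · show Xv z 2 = (√2)⁻¹ * (√2 * Xv z 2); rw [← mul_assoc, inv_mul_sqrt_two, one_mul]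
  rw [hh, map_smul]
  refine euclidean_ext fun i => ?_
  fin_cases i
  · rfl
  · rfl
  · rfl
  · show Xv z 3 = (√2)⁻¹ * (√2 * Xv z 3); rw [← mul_assoc, inv_mul_sqrt_two, one_mul]
  · show Xv z 4 = (√2)⁻¹ * (√2 * Xv z 4); rw [← mul_assoc, inv_mul_sqrt_two, one_mul]

end PolarExtension

/-! ### §5 Extension of a constant fibre diffeomorphism over the equatorial tube `W₀ ≅ S² × D²` -/

section EquatorExtension

/-- The position vector on the equatorial tube, `W₀ → ℝ⁵`. [folklore] -/
abbrev XW (q : EquatorTube) : 𝔼 5 := ι (RegularSublevel.incl isRegularLevel_tubeS q)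

/-- The position map `W₀ → ℝ⁵` is smooth. [folklore] -/
theorem contMDiff_XW : ContMDiff (𝓡∂ 4) 𝓘(ℝ, 𝔼 5) ∞ XW :=
  (RegularLevel.contMDiff_incl _).comp (RegularSublevel.contMDiff_incl isRegularLevel_tubeS)

/-- On `W₀`, `1 - u ≥ 1/2 > 0`. [folklore] -/
theorem one_sub_tubeFn_XW_pos (q : EquatorTube) : 0 < 1 - tubeFn (XW q) := by
  have h : tubeS (RegularSublevel.incl isRegularLevel_tubeS q) ≤ 1 / 2 :=
    RegularSublevel.apply_incl_le isRegularLevel_tubeS q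
  rw [tubeS] at h
  linarith

/-- `|head3 x|² = 1 - u` on `W₀`. [folklore] -/
theorem norm_head3_XW_sq (q : EquatorTube) : ‖head3 (XW q)‖ ^ 2 = 1 - tubeFn (XW q) := by
  have h := sqNorm_eq_head_add_tube (XW q)
  rw [sqNorm_ι] at h
  linarith

/-- The fibre radius `r = √(1 - u)` on `W₀`. [folklore] -/
def rW (q : EquatorTube) : ℝ := √(1 - tubeFn (XW q))

/-- `r > 0` on `W₀`. [folklore] -/
theorem rW_pos (q : EquatorTube) : 0 < rW q := Real.sqrt_pos.2 (one_sub_tubeFn_XW_pos q)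

/-- `r² = 1 - u`. [folklore] -/
theorem rW_sq (q : EquatorTube) : rW q ^ 2 = 1 - tubeFn (XW q) := Real.sq_sqrt (one_sub_tubeFn_XW_pos q).le

/-- `‖head3 x‖ = r`. [folklore] -/
theorem norm_head3_XW (q : EquatorTube) : ‖head3 (XW q)‖ = rW q := by
  have h1 := norm_head3_XW_sq q
  rw [← rW_sq] at h1
  exact (sq_eq_sq₀ (norm_nonneg _) (rW_pos q).le).1 h1

/-- `r` is smooth on `W₀` (`√` is smooth on positive reals). [folklore] -/
theorem contMDiff_rW : ContMDiff (𝓡∂ 4) 𝓘(ℝ, ℝ) ∞ rW := by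
  have hu : ContMDiff (𝓡∂ 4) 𝓘(ℝ, ℝ) ∞ fun q : EquatorTube => 1 - tubeFn (XW q) :=
    contMDiff_const.sub (contDiff_tubeFn.comp_contMDiff contMDiff_XW)
  intro q
  exact (Real.contDiffAt_sqrt (one_sub_tubeFn_XW_pos q).ne').comp_contMDiffAt
    (f := fun q : EquatorTube => 1 - tubeFn (XW q)) (hu q)

/-- The normalised fibre vector `(x₀, x₁, x₂)/r ∈ ℝ³` on `W₀`. [folklore] -/
def yWvec (q : EquatorTube) : 𝔼 3 := (rW q)⁻¹ • head3 (XW q)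

/-- The normalised fibre vector is a unit vector. [folklore] -/
theorem yWvec_mem_sphere (q : EquatorTube) : yWvec q ∈ Metric.sphere (0 : 𝔼 3) 1 := by
  rw [mem_sphere_zero_iff_norm, yWvec, norm_smul, norm_inv, Real.norm_eq_abs,
    abs_of_pos (rW_pos q), norm_head3_XW, inv_mul_cancel₀ (rW_pos q).ne']

/-- `yWvec` is smooth. [folklore] -/
theorem contMDiff_yWvec : ContMDiff (𝓡∂ 4) 𝓘(ℝ, 𝔼 3) ∞ yWvec :=
  (contMDiff_rW.inv₀ fun q => (rW_pos q).ne').smul (contDiff_head3.comp_contMDiff contMDiff_XW)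

/-- **The fibre coordinate** `yW : W₀ → S²`, `(x₀, x₁, x₂)/r`; on `∂W₀` it is `yS`. [folklore] -/
def yW : EquatorTube → (𝕊 2) := Set.codRestrict yWvec _ yWvec_mem_sphere

/-- Coordinate formula (definitional unfolding). [folklore] -/
@[simp] theorem coe_yW (q : EquatorTube) : ((yW q : 𝕊 2) : 𝔼 3) = yWvec q := rfl

/-- `yW` is smooth. [folklore] -/
theorem contMDiff_yW : ContMDiff (𝓡∂ 4) (𝓡 2) ∞ yW := contMDiff_yWvec.codRestrict_sphere _

/-- `r • yW = head3 x`. [folklore] -/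
theorem rW_smul_yW (q : EquatorTube) : rW q • ((yW q : 𝕊 2) : 𝔼 3) = head3 (XW q) := by
  rw [coe_yW, yWvec, smul_smul, mul_inv_cancel₀ (rW_pos q).ne', one_smul]

variable (g ginv : (𝕊 2) → (𝕊 2))

/-- **The vector field of the constant fibre map** `x ↦ (r · g((x₀,x₁,x₂)/r), x₃, x₄)` on the
equatorial tube (`(y, w) ↦ (g y, w)` on `W₀ ≅ S² × D²`). [folklore] -/
def constVec (q : EquatorTube) : 𝔼 5 := withHead (rW q • ((g (yW q) : 𝕊 2) : 𝔼 3)) (XW q)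

/-- `constVec` is smooth for smooth `g`. [folklore] -/
theorem contMDiff_constVec (hg : ContMDiff (𝓡 2) (𝓡 2) ∞ g) :
    ContMDiff (𝓡∂ 4) 𝓘(ℝ, 𝔼 5) ∞ (constVec g) := by
  have h1 : ContMDiff (𝓡∂ 4) 𝓘(ℝ, 𝔼 3) ∞ fun q : EquatorTube => ((g (yW q) : 𝕊 2) : 𝔼 3) :=
    contMDiff_coe_sphere.comp (hg.comp contMDiff_yW)
  have h2 : ContMDiff (𝓡∂ 4) 𝓘(ℝ, 𝔼 3) ∞ fun q : EquatorTube => rW q • ((g (yW q) : 𝕊 2) : 𝔼 3) :=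
    contMDiff_rW.smul h1
  exact contDiff_withHead.comp_contMDiff (h2.prodMk_space contMDiff_XW)

/-- `constVec` preserves the square norm. [folklore] -/
theorem sqNorm_constVec (q : EquatorTube) : sqNorm (constVec g q) = 1 := by
  rw [constVec, sqNorm_withHead, norm_smul, Real.norm_eq_abs, abs_of_pos (rW_pos q),
    norm_eq_of_mem_sphere, mul_one, rW_sq]
  ring

/-- `constVec` preserves the tube function. [folklore] -/
@[simp] theorem tubeFn_constVec (q : EquatorTube) : tubeFn (constVec g q) = tubeFn (XW q) := by
  rw [constVec, tubeFn_withHead]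

/-- `constVec` lands on Mathlib's unit sphere `𝕊⁴`. [folklore] -/
theorem constVec_mem_sphere (q : EquatorTube) : constVec g q ∈ Metric.sphere (0 : 𝔼 5) 1 := by
  have h := sqNorm_constVec g q
  rw [sqNorm_eq_norm_sq] at h
  rw [mem_sphere_zero_iff_norm]
  nlinarith [norm_nonneg (constVec g q)]

/-- The image point as a point of the level sphere `S`. [folklore] -/
def constS (q : EquatorTube) : LevelSphere :=
  sphereLevelDiffeomorph.symm (Set.codRestrict (constVec g) _ (constVec_mem_sphere g) q)

/-- `ι (constS q) = constVec q`. [folklore] -/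
@[simp] theorem ι_constS (q : EquatorTube) : ι (constS g q) = constVec g q := by
  have h := coe_sphereLevelDiffeomorph (sphereLevelDiffeomorph.symm
    (Set.codRestrict (constVec g) _ (constVec_mem_sphere g) q))
  rw [Diffeomorph.apply_symm_apply] at h
  rw [constS, ← h]
  rfl

/-- `constS` is smooth. [folklore] -/
theorem contMDiff_constS (hg : ContMDiff (𝓡 2) (𝓡 2) ∞ g) : ContMDiff (𝓡∂ 4) (𝓡 4) ∞ (constS g) :=
  sphereLevelDiffeomorph.symm.contMDiff.comp ((contMDiff_constVec g hg).codRestrict_sphere _)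

/-- `constS` stays in the equatorial tube. [folklore] -/
theorem constS_mem (q : EquatorTube) : tubeS (constS g q) ≤ 1 / 2 := by
  have h : tubeS (RegularSublevel.incl isRegularLevel_tubeS q) ≤ 1 / 2 :=
    RegularSublevel.apply_incl_le isRegularLevel_tubeS q
  rw [tubeS, ι_constS, tubeFn_constVec]
  exact h

/-- **The constant fibre self-map of the equatorial tube** `W₀` defined by `g : S² → S²`:
`(y, w) ↦ (g y, w)` on `W₀ ≅ S² × D²`. [folklore] -/
def constW : EquatorTube → EquatorTube := Set.codRestrict (constS g) _ (constS_mem g)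

/-- `constW` is smooth (Lee 2013, Cor. 5.30). [cite: LeeSmoothManifolds2013, Cor. 5.30] -/
theorem contMDiff_constW (hg : ContMDiff (𝓡 2) (𝓡 2) ∞ g) : ContMDiff (𝓡∂ 4) (𝓡∂ 4) ∞ (constW g) :=
  (RegularSublevel.halfSliceAtlas isRegularLevel_tubeS).contMDiff_codRestrict _ (contMDiff_constS g hg)

/-- Position of `constW q`. [folklore] -/
@[simp] theorem XW_constW (q : EquatorTube) : XW (constW g q) = constVec g q := ι_constS g q

/-- `constW` preserves the fibre radius. [folklore] -/
@[simp] theorem rW_constW (q : EquatorTube) : rW (constW g q) = rW q := by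
  rw [rW, rW, XW_constW, tubeFn_constVec]

/-- The fibre coordinate of `constW q` is `g (yW q)`. [folklore] -/
@[simp] theorem yW_constW (q : EquatorTube) : yW (constW g q) = g (yW q) := by
  apply Subtype.ext
  rw [coe_yW, yWvec, rW_constW, XW_constW, constVec, head3_withHead, smul_smul,
    inv_mul_cancel₀ (rW_pos q).ne', one_smul]

/-- Composition of two constant fibre maps with mutually inverse diffeomorphisms. [folklore] -/
theorem constW_constW (hgg : ∀ w, ginv (g w) = w) (q : EquatorTube) : constW ginv (constW g q) = q := by
  apply RegularSublevel.injective_incl isRegularLevel_tubeS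
  apply Subtype.ext
  show XW (constW ginv (constW g q)) = XW q
  rw [XW_constW, constVec, yW_constW, hgg, rW_constW, rW_smul_yW, XW_constW, constVec,
    withHead_withHead, withHead_head3]

/-- **The constant fibre diffeomorphism of the equatorial tube** defined by a diffeomorphism
`g` of `S²` (with inverse `ginv`): `(y, w) ↦ (g y, w)` on `W₀ ≅ S² × D²` — the extension over
`S² × D²` of the constant loop `(y, θ) ↦ (g y, θ)` of the boundary `S² × S¹`. [folklore] -/
def constDiffeo (hg : ContMDiff (𝓡 2) (𝓡 2) ∞ g) (hginv : ContMDiff (𝓡 2) (𝓡 2) ∞ ginv)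
    (h₁ : ∀ w, ginv (g w) = w) (h₂ : ∀ w, g (ginv w) = w) :
    EquatorTube ≃ₘ⟮𝓡∂ 4, 𝓡∂ 4⟯ EquatorTube where
  toFun := constW g
  invFun := constW ginv
  left_inv := constW_constW g ginv h₁
  right_inv := constW_constW ginv g h₂
  contMDiff_toFun := contMDiff_constW g hg
  contMDiff_invFun := contMDiff_constW ginv hginv

variable {g ginv}

/-- `constDiffeo` as a function. [folklore] -/
@[simp] theorem coe_constDiffeo (hg : ContMDiff (𝓡 2) (𝓡 2) ∞ g) (hginv : ContMDiff (𝓡 2) (𝓡 2) ∞ ginv)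
    (h₁ : ∀ w, ginv (g w) = w) (h₂ : ∀ w, g (ginv w) = w) :
    ⇑(constDiffeo g ginv hg hginv h₁ h₂) = constW g := rfl

/-- On the level torus (read from the equatorial side) the fibre radius is `1/√2`. [folklore] -/
theorem rW_splitL_symm (z : LevelTorus) : rW (splitL.symm z).1 = (√2)⁻¹ := by
  have hX : XW (splitL.symm z).1 = Xv z := Xw_splitL_symm z
  rw [rW, hX, tubeFn_Xv, show (1 : ℝ) - 1 / 2 = 1 / 2 by norm_num, Real.sqrt_div' _ zero_le_two,
    Real.sqrt_one, one_div]

/-- On the level torus (read from the equatorial side) the fibre coordinate `yW` is `yS`.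
[folklore] -/
theorem yW_splitL_symm (z : LevelTorus) : yW (splitL.symm z).1 = yS z := by
  apply Subtype.ext
  have hX : XW (splitL.symm z).1 = Xv z := Xw_splitL_symm z
  rw [coe_yW, yWvec, rW_splitL_symm, inv_inv, hX, coe_yS]
  refine euclidean_ext fun i => ?_
  fin_cases i <;> rfl

/-- **The restriction of `constDiffeo g` to the level torus is the fibrewise map of the constant
family `g`** (the level read from `W₀` and from `V₀` being identified by `splitL`). [folklore] -/
theorem restrictDiffeomorph_constDiffeo (hg : ContMDiff (𝓡 2) (𝓡 2) ∞ g)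
    (hginv : ContMDiff (𝓡 2) (𝓡 2) ∞ ginv) (h₁ : ∀ w, ginv (g w) = w) (h₂ : ∀ w, g (ginv w) = w)
    (z : LevelTorus) :
    splitL ((RegularSublevel.boundaryData isRegularLevel_tubeS).restrictDiffeomorph
        (RegularSublevel.boundaryData isRegularLevel_tubeS) (constDiffeo g ginv hg hginv h₁ h₂)
          (splitL.symm z)) =
      fibrewiseFun (fun _ w => g w) z := by
  apply injective_Xv
  have hincl := BoundaryData.incl_restrictDiffeomorph
    (b₁ := RegularSublevel.boundaryData isRegularLevel_tubeS)
    (b₂ := RegularSublevel.boundaryData isRegularLevel_tubeS)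
    (constDiffeo g ginv hg hginv h₁ h₂) (splitL.symm z)
  have hL : Xv (splitL ((RegularSublevel.boundaryData isRegularLevel_tubeS).restrictDiffeomorph
      (RegularSublevel.boundaryData isRegularLevel_tubeS) (constDiffeo g ginv hg hginv h₁ h₂)
        (splitL.symm z))) = constVec g (splitL.symm z).1 := by
    rw [Xv_splitL]
    show XW ((RegularSublevel.boundaryData isRegularLevel_tubeS).incl _) = _
    rw [hincl]
    exact XW_constW g _
  have hX : XW (splitL.symm z).1 = Xv z := Xw_splitL_symm z
  rw [hL, fibrewiseFun, Xv_P, constVec, rW_splitL_symm, yW_splitL_symm, hX]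
  refine euclidean_ext fun i => ?_
  fin_cases i
  · rfl
  · rfl
  · rfl
  · show Xv z 3 = (√2)⁻¹ * (√2 * Xv z 3); rw [← mul_assoc, inv_mul_sqrt_two, one_mul]
  · show Xv z 4 = (√2)⁻¹ * (√2 * Xv z 4); rw [← mul_assoc, inv_mul_sqrt_two, one_mul]

end EquatorExtension

end SphereFourSplitting

end Literature.Topology.FourManifolds
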